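import Literature.MathematicalPhysics.StatisticalMechanics.CanonicalGasSpectralGap
import Mathlib.Analysis.InnerProductSpace.Projection.Submodule
import Mathlib.Analysis.InnerProductSpace.Dual
import Mathlib.Algebra.QuadraticDiscriminant
import Mathlib.MeasureTheory.Function.L2Space
import Mathlib.MeasureTheory.Function.SimpleFuncDenseLp
import Mathlib.MeasureTheory.Integral.Bochner.ContinuousLinearMap
import Mathlib.MeasureTheory.Measure.Prod
import Mathlib.MeasureTheory.Integral.Prod
import Mathlib.MeasureTheory.Group.Integral
import HarnessLib

/-!
# The spectral gap of the move-one-particle dynamics of the canonical continuum gas: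
# proof of `BCDP2006_canonicalGas_gap`

Topic `Literature/MathematicalPhysics/StatisticalMechanics`; PROOFS (no named facts, no new notions
beyond proof-internal bookkeeping) discharging the named fact
`Literature.MathematicalPhysics.StatisticalMechanics.BCDP2006_canonicalGas_gap` of
`CanonicalGasSpectralGap.lean`: the final declaration is
`theorem BCDP2006_canonicalGas_gap_holds : BCDP2006_canonicalGas_gap`.

## Source and architecture (we follow the printed proof)

A.-S. Boudou, P. Caputo, P. Dai Pra, G. Posta, *Spectral gap estimates for interacting particle
systems via a Bochner-type identity*, J. Funct. Anal. 232 (2006) 222–258 = arXiv:math/0505533,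
§2 (Prop. 2.1, Lemma 2.1, Cor. 2.1–2.2) and §5 (Lemma 5.1, Thm 5.1, Cor. 5.2).

* §`Abstract` — **Prop. 2.1** (`gap(𝓛)` is the best constant in `k 𝓔(f,f) ≤ ν[(𝓛f)²]`), the
  direction we need, for a bounded symmetric nonnegative operator `A = -𝓛` on a real Hilbert
  space, proved WITHOUT the spectral theorem: Cauchy–Schwarz for `⟪A·,·⟫` gives the Poincaré
  inequality on `range A`, and `closure (range A) = (ker A)ᗮ`
  (`le_inner_map_self_of_forall_ker`).
* §`Swap`, §`Model` — the model of §5 in labelled coordinates `w : Fin N → ℝ^d`: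
  `ν = Z⁻¹ e^{-βH} dw` on `Λ^N`, the rates `e^{-βΣ_{j≠i}φ(w_j - z)}`, the flux measures
  `R_i(dw dz) = ν(dw) rate_i dz` and **reversibility** (the paper's "change of variables
  `w₁ ↦ z ↦ w₁`", Lemma 5.1): the exchange `(w, z) ↦ (w^{i→z}, wᵢ)` preserves `dw ⊗ dz`
  (`measurePreserving_swapUpd`, a coordinate permutation of `Λ^{N+1}`) and the energy
  `H(w) + Σ_{j≠i} φ(w_j - z)` (`pairW_swapUpd`, evenness of `φ`), hence `R_i`.
* §`Form`, §`Generator` — the Dirichlet form (5.3) as a bounded bilinear form on `L²(ν)` (the rates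
  are `≤ 1`), the generator `A = -𝓛` by Riesz representation (`genOp`), and its action
  `A[f] = [Σ_i |Λ|⁻¹ ∫ rate_i (f - f∘γ_{iz}) dz]` on bounded measurable `f` (`genOp_toLp`,
  integration by parts (2.4)).
* §`Ergodic` — `ker 𝓛 =` constants (`𝓔(g,g) = 0` forces invariance under every single-particle
  resampling, hence a.e. constancy by iterated averaging; all rates are positive since `φ < ∞`).
* §`Triple`, §`Estimate` — two moving particles: the measures `R_{ij}` of Lemma 5.1 with their
  symmetries (A2)–(A4); the **Bochner identity** Lemma 2.1 in the concrete form
  `C_{ij} = ∫ (a-b)(a-c) dR_{ij} = ¼ ∫ (a-b-c+d)² ≥ 0` (`bochner_nonneg`); the diagonal term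
  (5.5)–(5.6) `2∫(G_i f)² dν = ∫ m_i (∇̃_i f)² dR_i ≥ (|Λ| - (N-1)ε) 𝓔_i` and the error term
  `|B_{ij}| ≤ ε/2 (𝓔_i + 𝓔_j)` with the Cor. 5.2 bounds `ε₁, ε₂/2 ≤ (N-1)ε(β)/|Λ|`
  (§`EpsBounds`: `1 - e^{-s-t} ≤ (1-e^{-s}) + (1-e^{-t})`, translation invariance); summing,
  `(1 - 3(N-1)ε/|Λ|) 𝓔(f,f) ≤ ν[(𝓛f)²]` (`bakryEmery_estimate`).
* §`Main` — Fubini identifies the statement's Dirichlet form with `𝓔(f,f)`, `‖[f - ν f]‖² = Var_ν f`,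
  and Prop. 2.1 concludes.

Deviations from the paper: none in substance; the symmetry of `f` under permutations of labels is
not needed (the labelled computation holds for every bounded measurable `f` on `Λ^N`), and `β ≥ 0`
suffices.
-/

open MeasureTheory Function Set Filter Topology
open scoped ENNReal InnerProductSpace

namespace Literature.MathematicalPhysics.StatisticalMechanics

noncomputable section


section Abstract

variable {E : Type*} [NormedAddCommGroup E] [InnerProductSpace ℝ E]

/-- Cauchy–Schwarz for the nonnegative symmetric form `(u, v) ↦ ⟪A u, v⟫` of a positive symmetric
bounded operator: `⟪A u, v⟫² ≤ ⟪A u, u⟫ ⟪A v, v⟫`. [folklore] -/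
theorem inner_map_sq_le_of_symm_nonneg (A : E →L[ℝ] E) (hsym : ∀ x y, ⟪A x, y⟫_ℝ = ⟪x, A y⟫_ℝ)
    (hpos : ∀ x, 0 ≤ ⟪A x, x⟫_ℝ) (u v : E) :
    ⟪A u, v⟫_ℝ ^ 2 ≤ ⟪A u, u⟫_ℝ * ⟪A v, v⟫_ℝ := by
  have hquad : ∀ t : ℝ, 0 ≤ ⟪A v, v⟫_ℝ * (t * t) + (-(2 * ⟪A u, v⟫_ℝ)) * t + ⟪A u, u⟫_ℝ := by
    intro t
    have h := hpos (u - t • v)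
    have hvu : ⟪A v, u⟫_ℝ = ⟪A u, v⟫_ℝ := by rw [hsym, real_inner_comm]
    rw [map_sub, map_smul, inner_sub_left, inner_sub_right, inner_sub_right, inner_smul_left,
      inner_smul_left, inner_smul_right, inner_smul_right, hvu] at h
    simp only [conj_trivial] at h
    nlinarith [h]
  have hd := discrim_le_zero hquad
  rw [discrim] at hd
  nlinarith [hd]

variable [CompleteSpace E]

/-- **Abstract Bakry–Émery criterion** (Boudou–Caputo–Dai Pra–Posta 2006, Prop. 2.1, the
direction used for lower bounds, proved here without the spectral theorem): let `A` be a bounded,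
symmetric, nonnegative operator on a real Hilbert space and suppose the Bakry–Émery inequality
`k ⟪A x, x⟫ ≤ ‖A x‖²` holds on a dense set. Then `k ‖f‖² ≤ ⟪A f, f⟫` for every `f` orthogonal to
`ker A` (the Poincaré inequality with constant `k`). Proof: Cauchy–Schwarz for `⟪A ·, ·⟫` gives the
inequality on `range A`, which is dense in `(ker A)ᗮ`.
[cite: BoudouCaputoDaiPraPosta2006, Prop. 2.1] -/
theorem le_inner_map_self_of_forall_ker (A : E →L[ℝ] E) (hsym : ∀ x y, ⟪A x, y⟫_ℝ = ⟪x, A y⟫_ℝ)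
    (hpos : ∀ x, 0 ≤ ⟪A x, x⟫_ℝ) {k : ℝ} {S : Set E} (hS : Dense S)
    (hBE : ∀ x ∈ S, k * ⟪A x, x⟫_ℝ ≤ ‖A x‖ ^ 2) {f : E}
    (hf : ∀ g, A g = 0 → ⟪g, f⟫_ℝ = 0) : k * ‖f‖ ^ 2 ≤ ⟪A f, f⟫_ℝ := by
  -- Step 0: the Bakry–Émery inequality everywhere, by density
  have hcont1 : Continuous fun x : E => ⟪A x, x⟫_ℝ := (A.continuous).inner continuous_id
  have hBE' : ∀ x, k * ⟪A x, x⟫_ℝ ≤ ‖A x‖ ^ 2 := by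
    have hclosed : IsClosed {x : E | k * ⟪A x, x⟫_ℝ ≤ ‖A x‖ ^ 2} :=
      isClosed_le (continuous_const.mul hcont1) ((continuous_norm.comp A.continuous).pow 2)
    intro x
    have hx : x ∈ closure S := by rw [hS.closure_eq]; exact Set.mem_univ x
    exact closure_minimal (fun y hy => hBE y hy) hclosed hx
  -- Step 1: the Poincaré inequality on `range A`
  have hrange : ∀ h, k * ‖A h‖ ^ 2 ≤ ⟪A (A h), A h⟫_ℝ := by
    intro h
    rcases le_or_gt k 0 with hk | hk
    · exact (mul_nonpos_of_nonpos_of_nonneg hk (sq_nonneg _)).trans (hpos _)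
    have hCS := inner_map_sq_le_of_symm_nonneg A hsym hpos h (A h)
    have ha2 : ⟪A h, A h⟫_ℝ = ‖A h‖ ^ 2 := real_inner_self_eq_norm_sq _
    rw [ha2] at hCS
    have h1 := hBE' h
    have h3 := hpos (A h)
    rcases (sq_nonneg ‖A h‖).eq_or_lt with h0 | h0
    · rw [← h0, mul_zero]; exact h3
    · -- `k a₂² ≤ k a₁ a₃ ≤ a₂ a₃`
      have : k * (‖A h‖ ^ 2) * (‖A h‖ ^ 2) ≤ (‖A h‖ ^ 2) * ⟪A (A h), A h⟫_ℝ := by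
        calc k * (‖A h‖ ^ 2) * (‖A h‖ ^ 2) = k * (‖A h‖ ^ 2) ^ 2 := by ring
          _ ≤ k * (⟪A h, h⟫_ℝ * ⟪A (A h), A h⟫_ℝ) := mul_le_mul_of_nonneg_left hCS hk.le
          _ = (k * ⟪A h, h⟫_ℝ) * ⟪A (A h), A h⟫_ℝ := by ring
          _ ≤ (‖A h‖ ^ 2) * ⟪A (A h), A h⟫_ℝ := mul_le_mul_of_nonneg_right h1 h3
      nlinarith [this, h0]
  -- Step 2: hence on the closure of `range A`
  have hclosed : IsClosed {y : E | k * ‖y‖ ^ 2 ≤ ⟪A y, y⟫_ℝ} :=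
    isClosed_le (continuous_const.mul (continuous_norm.pow 2)) hcont1
  have hsub : (Set.range A : Set E) ⊆ {y : E | k * ‖y‖ ^ 2 ≤ ⟪A y, y⟫_ℝ} := by
    rintro _ ⟨h, rfl⟩; exact hrange h
  -- Step 3: `f ∈ closure (range A) = (ker A)ᗮ`
  have hmem : f ∈ closure (Set.range A : Set E) := by
    have hK : f ∈ (LinearMap.range (A : E →ₗ[ℝ] E))ᗮᗮ := by
      rw [Submodule.mem_orthogonal]
      intro g hg
      rw [Submodule.mem_orthogonal] at hg
      have hAg : A g = 0 := by
        have h0 := hg _ (LinearMap.mem_range_self (A : E →ₗ[ℝ] E) (A g))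
        rw [ContinuousLinearMap.coe_coe, hsym] at h0
        exact inner_self_eq_zero.1 h0
      exact hf g hAg
    rw [Submodule.orthogonal_orthogonal_eq_closure] at hK
    have h2 : f ∈ ((LinearMap.range (A : E →ₗ[ℝ] E)).topologicalClosure : Set E) := hK
    rw [Submodule.topologicalClosure_coe, LinearMap.coe_range] at h2
    exact h2
  exact closure_minimal hsub hclosed hmem

end Abstract


section Swap

variable {α : Type*} {N : ℕ}

/-- The exchange of the `i`-th coordinate of a labelled configuration `w : Fin N → α` with an
extra point `z`: `(w, z) ↦ (w with wᵢ := z, wᵢ)` ("move particle `i` to `z` and remember where it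
came from"). [folklore] -/
def swapUpd (i : Fin N) (p : (Fin N → α) × α) : (Fin N → α) × α := (update p.1 i p.2, p.1 i)

/-- First component of the exchange map. [folklore] -/
@[simp] theorem swapUpd_fst (i : Fin N) (p : (Fin N → α) × α) : (swapUpd i p).1 = update p.1 i p.2 :=
  rfl

/-- Second component of the exchange map. [folklore] -/
@[simp] theorem swapUpd_snd (i : Fin N) (p : (Fin N → α) × α) : (swapUpd i p).2 = p.1 i := rfl

/-- `swapUpd i` is an involution. [folklore] -/
@[simp] theorem swapUpd_swapUpd (i : Fin N) (p : (Fin N → α) × α) : swapUpd i (swapUpd i p) = p := by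
  obtain ⟨w, z⟩ := p
  simp only [swapUpd, update_idem, update_self, Prod.mk.injEq, and_true]
  exact update_eq_self i w

variable [MeasurableSpace α]

/-- `swapUpd i` is measurable. [folklore] -/
@[fun_prop]
theorem measurable_swapUpd (i : Fin N) : Measurable (swapUpd (α := α) i) :=
  measurable_update'.prodMk ((measurable_pi_apply i).comp measurable_fst)

/-- `swapUpd i` as a measurable involution. [folklore] -/
def swapUpdEquiv (i : Fin N) : (Fin N → α) × α ≃ᵐ (Fin N → α) × α where
  toFun := swapUpd i
  invFun := swapUpd i
  left_inv := swapUpd_swapUpd i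
  right_inv := swapUpd_swapUpd i
  measurable_toFun := measurable_swapUpd i
  measurable_invFun := measurable_swapUpd i

/-- The exchange equivalence is the exchange map. [folklore] -/
@[simp] theorem coe_swapUpdEquiv (i : Fin N) : ⇑(swapUpdEquiv (α := α) i) = swapUpd i := rfl

/-- **The exchange map preserves the product measure** `μ^{⊗N} ⊗ μ`: it is conjugate, through
`(Fin N → α) × α ≃ (Fin (N+1) → α)`, to a permutation of coordinates. [folklore] -/
theorem measurePreserving_swapUpd (μ : Measure α) [SigmaFinite μ] (i : Fin N) :
    MeasurePreserving (swapUpd i) ((Measure.pi fun _ : Fin N => μ).prod μ)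
      ((Measure.pi fun _ : Fin N => μ).prod μ) := by
  set e := MeasurableEquiv.piFinSuccAbove (fun _ : Fin (N + 1) => α) (Fin.last N) with he_def
  have he : MeasurePreserving e (Measure.pi fun _ => μ) (μ.prod (Measure.pi fun _ : Fin N => μ)) :=
    measurePreserving_piFinSuccAbove (fun _ => μ) (Fin.last N)
  set σ : Equiv.Perm (Fin (N + 1)) := Equiv.swap (Fin.castSucc i) (Fin.last N) with hσ_def
  have hs : MeasurePreserving (MeasurableEquiv.piCongrLeft (fun _ : Fin (N + 1) => α) σ)
      (Measure.pi fun _ => μ) (Measure.pi fun _ => μ) :=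
    measurePreserving_piCongrLeft (fun _ => μ) σ
  have h1 : MeasurePreserving (Prod.swap : (Fin N → α) × α → α × (Fin N → α))
      ((Measure.pi fun _ : Fin N => μ).prod μ) (μ.prod (Measure.pi fun _ : Fin N => μ)) :=
    Measure.measurePreserving_swap
  have h2 : MeasurePreserving (Prod.swap : α × (Fin N → α) → (Fin N → α) × α)
      (μ.prod (Measure.pi fun _ : Fin N => μ)) ((Measure.pi fun _ : Fin N => μ).prod μ) :=
    Measure.measurePreserving_swap
  have hcomp := h2.comp (he.comp (hs.comp (he.symm.comp h1)))
  convert hcomp using 1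
  funext ⟨w, z⟩
  simp only [Function.comp_apply, Prod.swap_prod_mk, he_def, MeasurableEquiv.piFinSuccAbove_symm_apply,
    MeasurableEquiv.piFinSuccAbove_apply, MeasurableEquiv.coe_piCongrLeft, Fin.insertNthEquiv,
    swapUpd, Equiv.coe_fn_mk, Equiv.coe_fn_symm_mk, Prod.mk.injEq]
  have hval : ∀ j : Fin (N + 1), (Equiv.piCongrLeft (fun _ => α) (Equiv.swap i.castSucc (Fin.last N)))
      (Fin.snoc w z) j = Fin.snoc (α := fun _ => α) w z (Equiv.swap i.castSucc (Fin.last N) j) := by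
    intro j
    rw [Equiv.piCongrLeft_apply_eq_cast, cast_eq, Equiv.symm_swap]
  simp only [Fin.insertNth_last', hσ_def]
  refine ⟨?_, ?_⟩
  · funext j
    change update w i z j = (Equiv.piCongrLeft (fun _ => α) (Equiv.swap i.castSucc (Fin.last N)))
      (Fin.snoc w z) ((Fin.last N).succAbove j)
    rw [Fin.succAbove_last, hval, Equiv.swap_apply_def]
    by_cases hji : j = i
    · subst hji
      simp only [if_true, Fin.snoc_last, update_self]
    · have h1 : Fin.castSucc j ≠ Fin.castSucc i := fun h => hji (Fin.castSucc_injective _ h)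
      have h2 : Fin.castSucc j ≠ Fin.last N := (Fin.castSucc_lt_last j).ne
      simp only [h1, if_false, h2, Fin.snoc_castSucc, update_of_ne hji]
  · rw [hval, Equiv.swap_apply_right, Fin.snoc_castSucc]

end Swap


/-- Points of `ℝ^d`. [folklore] -/
abbrev Pt (d : ℕ) := EuclideanSpace ℝ (Fin d)

/-- Labelled `N`-particle configurations in `ℝ^d`. [folklore] -/
abbrev Conf (d N : ℕ) := Fin N → Pt d

/-- The data of the canonical continuum gas of BCDP 2006 §5: an even nonnegative measurable pair
potential `φ`, an inverse temperature `β ≥ 0` and a bounded Borel region `Λ` of positive volume.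
[cite: BoudouCaputoDaiPraPosta2006, §5] -/
structure GasModel (d : ℕ) where
  /-- the pair potential -/
  φ : Pt d → ℝ
  /-- the inverse temperature -/
  β : ℝ
  /-- the region -/
  Λ : Set (Pt d)
  /-- `φ` is measurable -/
  measurable_φ : Measurable φ
  /-- `φ ≥ 0` -/
  φ_nonneg : ∀ x, 0 ≤ φ x
  /-- `φ` is even -/
  φ_even : ∀ x, φ (-x) = φ x
  /-- `β ≥ 0` -/
  β_nonneg : 0 ≤ β
  /-- `ε(β) = ∫ (1 - e^{-βφ}) < ∞` -/
  integrable_oneSubExp : Integrable (fun x => 1 - Real.exp (-(β * φ x))) (volume : Measure (Pt d))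
  /-- `Λ` is Borel -/
  measurableSet_Λ : MeasurableSet Λ
  /-- `Λ` is bounded -/
  isBounded_Λ : Bornology.IsBounded Λ
  /-- `|Λ| > 0` -/
  volume_Λ_ne_zero : volume Λ ≠ 0

namespace GasModel

variable {d : ℕ} (P : GasModel d)

/-! #### One particle: Lebesgue measure on `Λ` -/

/-- Lebesgue measure restricted to `Λ` (the a priori one-particle measure `dz` on `Λ`). [folklore] -/
def μ₀ : Measure (Pt d) := volume.restrict P.Λ

/-- `|Λ| < ∞`. [folklore] -/
theorem volume_Λ_lt_top : volume P.Λ < ∞ := P.isBounded_Λ.measure_lt_top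

/-- `μ₀(ℝ^d) = |Λ|`. [folklore] -/
@[simp] theorem μ₀_univ : P.μ₀ univ = volume P.Λ := by
  rw [μ₀, Measure.restrict_apply_univ]

/-- `dz|_Λ` is a finite measure (`Λ` is bounded). [folklore] -/
instance : IsFiniteMeasure P.μ₀ := ⟨by rw [μ₀_univ]; exact P.volume_Λ_lt_top⟩

/-- The volume `|Λ|` as a real number. [folklore] -/
def vol : ℝ := (volume P.Λ).toReal

/-- `0 < |Λ|`. [folklore] -/
theorem vol_pos : 0 < P.vol := ENNReal.toReal_pos P.volume_Λ_ne_zero P.volume_Λ_lt_top.ne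

/-- `μ₀.real univ = |Λ|`. [folklore] -/
@[simp] theorem μ₀_real_univ : P.μ₀.real univ = P.vol := by
  rw [Measure.real, μ₀_univ, vol]

/-- `μ₀ ≤ Lebesgue`. [folklore] -/
theorem μ₀_le_volume : P.μ₀ ≤ volume := Measure.restrict_le_self

/-- The high-temperature/low-density parameter `ε(β) = ∫ (1 - e^{-β φ})`. [cite: BoudouCaputoDaiPraPosta2006, §5 Cor. 5.2] -/
def ε : ℝ := ∫ x, (1 - Real.exp (-(P.β * P.φ x)))

/-- `0 ≤ 1 - e^{-β φ(x)} ≤ 1`. [folklore] -/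
theorem oneSubExp_nonneg (x : Pt d) : 0 ≤ 1 - Real.exp (-(P.β * P.φ x)) := by
  have : Real.exp (-(P.β * P.φ x)) ≤ 1 :=
    Real.exp_le_one_iff.2 (neg_nonpos.2 (mul_nonneg P.β_nonneg (P.φ_nonneg x)))
  linarith

/-- `0 ≤ ε(β)`. [folklore] -/
theorem ε_nonneg : 0 ≤ P.ε := integral_nonneg P.oneSubExp_nonneg

variable (N : ℕ)

/-! #### `N` particles: energy, reference measure, Gibbs measure -/

/-- The pair energy `H(w) = Σ_{i<j} φ(wᵢ - wⱼ)`. [cite: BoudouCaputoDaiPraPosta2006, §5] -/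
def H (w : Conf d N) : ℝ := ∑ i : Fin N, ∑ j : Fin N, if i < j then P.φ (w i - w j) else 0

/-- `0 ≤ H`. [folklore] -/
theorem H_nonneg (w : Conf d N) : 0 ≤ P.H N w :=
  Finset.sum_nonneg fun i _ => Finset.sum_nonneg fun j _ => by
    split_ifs
    · exact P.φ_nonneg _
    · exact le_rfl

/-- `H` is measurable. [folklore] -/
@[fun_prop]
theorem measurable_H : Measurable (P.H N) := by
  refine Finset.measurable_sum _ fun i _ => Finset.measurable_sum _ fun j _ => ?_
  split_ifs
  · exact P.measurable_φ.comp ((measurable_pi_apply i).sub (measurable_pi_apply j))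
  · exact measurable_const

/-- The reference measure `dw = ⊗_{i<N} dz|_Λ` on `Λ^N`. [folklore] -/
def ref : Measure (Conf d N) := Measure.pi fun _ : Fin N => P.μ₀

/-- `dw` is a finite measure. [folklore] -/
instance : IsFiniteMeasure (P.ref N) := by unfold ref; infer_instance

/-- `ref(Λ^N) = |Λ|^N`. [folklore] -/
theorem ref_univ : P.ref N univ = volume P.Λ ^ N := by
  rw [ref, ← pi_univ (univ : Set (Fin N)), Measure.pi_pi]
  simp

/-- The Boltzmann weight `e^{-β H(w)}`. [folklore] -/
def wt (w : Conf d N) : ℝ := Real.exp (-(P.β * P.H N w))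

/-- `0 < e^{-βH}`. [folklore] -/
theorem wt_pos (w : Conf d N) : 0 < P.wt N w := Real.exp_pos _

/-- `e^{-βH} ≤ 1`. [folklore] -/
theorem wt_le_one (w : Conf d N) : P.wt N w ≤ 1 :=
  Real.exp_le_one_iff.2 (neg_nonpos.2 (mul_nonneg P.β_nonneg (P.H_nonneg N w)))

/-- `e^{-βH}` is measurable. [folklore] -/
@[fun_prop]
theorem measurable_wt : Measurable (P.wt N) := by unfold wt; fun_prop

/-- `e^{-βH}` is integrable on `Λ^N`. [folklore] -/
theorem integrable_wt : Integrable (P.wt N) (P.ref N) :=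
  (integrable_const (1 : ℝ)).mono' (P.measurable_wt N).aestronglyMeasurable
    (Eventually.of_forall fun w => by
      rw [Real.norm_eq_abs, abs_of_pos (P.wt_pos N w)]; exact P.wt_le_one N w)

/-- The partition function `Z = ∫ e^{-βH} dw`. [folklore] -/
def Z : ℝ := ∫ w, P.wt N w ∂P.ref N

/-- `0 < Z` (since `|Λ| > 0` and `e^{-βH} > 0`). [folklore] -/
theorem Z_pos : 0 < P.Z N := by
  rw [Z, integral_pos_iff_support_of_nonneg (fun w => (P.wt_pos N w).le) (P.integrable_wt N)]
  have hsupp : support (P.wt N) = univ := by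
    ext w; simp [(P.wt_pos N w).ne']
  rw [hsupp, ref_univ]
  exact ENNReal.pow_pos (pos_iff_ne_zero.2 P.volume_Λ_ne_zero) N

/-- The canonical Gibbs measure `ν = Z⁻¹ e^{-βH(w)} dw` on `Λ^N`, written exactly as in the
statement of `BCDP2006_canonicalGas_gap`. [cite: BoudouCaputoDaiPraPosta2006, §5] -/
def ν : Measure (Conf d N) :=
  (ENNReal.ofReal (P.Z N)⁻¹) • (P.ref N).withDensity fun w => ENNReal.ofReal (P.wt N w)

/-- The density `Z⁻¹ e^{-βH}` of `ν` with respect to `dw`. [folklore] -/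
def dens (w : Conf d N) : ℝ := (P.Z N)⁻¹ * P.wt N w

/-- `0 < Z⁻¹ e^{-βH}`. [folklore] -/
theorem dens_pos (w : Conf d N) : 0 < P.dens N w := mul_pos (inv_pos.2 (P.Z_pos N)) (P.wt_pos N w)

/-- The density of `ν` is measurable. [folklore] -/
@[fun_prop]
theorem measurable_dens : Measurable (P.dens N) := by unfold dens; fun_prop

/-- `ν = (Z⁻¹ e^{-βH}) · dw`. [folklore] -/
theorem ν_eq_withDensity : P.ν N = (P.ref N).withDensity fun w => ENNReal.ofReal (P.dens N w) := by
  rw [ν]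
  have : (fun w => ENNReal.ofReal (P.dens N w)) =
      (ENNReal.ofReal (P.Z N)⁻¹) • fun w => ENNReal.ofReal (P.wt N w) := by
    funext w
    simp only [dens, Pi.smul_apply, smul_eq_mul]
    rw [ENNReal.ofReal_mul (inv_pos.2 (P.Z_pos N)).le]
  rw [this, withDensity_smul _ (P.measurable_wt N).ennreal_ofReal]

/-- Integration against `ν` is integration against `Z⁻¹ e^{-βH} dw`. [folklore] -/
theorem integral_ν {E : Type*} [NormedAddCommGroup E] [NormedSpace ℝ E] (g : Conf d N → E) :
    ∫ w, g w ∂P.ν N = ∫ w, P.dens N w • g w ∂P.ref N := by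
  rw [ν_eq_withDensity, integral_withDensity_eq_integral_toReal_smul (P.measurable_dens N).ennreal_ofReal
    (Eventually.of_forall fun _ => ENNReal.ofReal_lt_top)]
  refine integral_congr_ae (Eventually.of_forall fun w => ?_)
  dsimp only
  rw [ENNReal.toReal_ofReal (P.dens_pos N w).le]

/-- The canonical Gibbs measure is a probability measure (`Z⁻¹` normalises it). [folklore] -/
instance : IsProbabilityMeasure (P.ν N) := by
  constructor
  rw [ν_eq_withDensity, withDensity_apply _ MeasurableSet.univ, Measure.restrict_univ,
    ← ofReal_integral_eq_lintegral_ofReal]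
  · simp only [dens]
    rw [integral_const_mul, ← Z, inv_mul_cancel₀ (P.Z_pos N).ne', ENNReal.ofReal_one]
  · exact (P.integrable_wt N).const_mul _
  · exact Eventually.of_forall fun w => (P.dens_pos N w).le

/-- `ν ≪ dw`. [folklore] -/
theorem ν_absolutelyContinuous : P.ν N ≪ P.ref N := by
  rw [ν_eq_withDensity]; exact withDensity_absolutelyContinuous _ _

/-- `dw ≪ ν` (the density is positive). [folklore] -/
theorem ref_absolutelyContinuous_ν : P.ref N ≪ P.ν N := by
  rw [ν_eq_withDensity]
  exact withDensity_absolutelyContinuous' (P.measurable_dens N).ennreal_ofReal.aemeasurable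
    (Eventually.of_forall fun w => (ENNReal.ofReal_pos.2 (P.dens_pos N w)).ne')

/-! #### Combinatorics of the pair energy -/

/-- `Σ_j [j ≠ i] g j = Σ_{j ∈ univ \ {i}} g j`. [folklore] -/
theorem sum_ite_ne {M : Type*} [AddCommMonoid M] (g : Fin N → M) (i : Fin N) :
    (∑ j, if j ≠ i then g j else 0) = ∑ j ∈ Finset.univ.erase i, g j := by
  rw [← Finset.sum_filter, Finset.filter_ne']

/-- The symmetrised pair energy: `2 H(w) = Σ_{a ≠ b} φ(w_a - w_b)` (`φ` is even). [folklore] -/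
theorem two_mul_H (w : Conf d N) :
    2 * P.H N w = ∑ a, ∑ b ∈ Finset.univ.erase a, P.φ (w a - w b) := by
  have hsym : ∀ a b : Fin N, P.φ (w a - w b) = P.φ (w b - w a) := fun a b => by
    rw [← P.φ_even, neg_sub]
  have h1 : ∀ a : Fin N, ∑ b ∈ Finset.univ.erase a, P.φ (w a - w b) =
      (∑ b, if a < b then P.φ (w a - w b) else 0) + ∑ b, if b < a then P.φ (w a - w b) else 0 := by
    intro a
    rw [← sum_ite_ne, ← Finset.sum_add_distrib]
    refine Finset.sum_congr rfl fun b _ => ?_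
    rcases lt_trichotomy a b with h | h | h
    · simp [h, h.ne', h.not_gt]
    · simp [h]
    · simp [h, h.ne, h.not_gt]
  simp_rw [h1, Finset.sum_add_distrib]
  rw [two_mul, H]
  congr 1
  rw [Finset.sum_comm]
  refine Finset.sum_congr rfl fun a _ => Finset.sum_congr rfl fun b _ => ?_
  split_ifs
  · exact hsym _ _
  · rfl

/-- Splitting `Σ_{a ≠ b} F a b` at a label `i`: the pairs through `i` and the rest. [folklore] -/
theorem sum_erase_split (F : Fin N → Fin N → ℝ) (i : Fin N) :
    ∑ a, ∑ b ∈ Finset.univ.erase a, F a b =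
      (∑ b ∈ Finset.univ.erase i, F i b) + (∑ a ∈ Finset.univ.erase i, F a i) +
        ∑ a ∈ Finset.univ.erase i, ∑ b ∈ (Finset.univ.erase a).erase i, F a b := by
  have h1 : ∑ a, ∑ b ∈ Finset.univ.erase a, F a b =
      (∑ b ∈ Finset.univ.erase i, F i b) + ∑ a ∈ Finset.univ.erase i, ∑ b ∈ Finset.univ.erase a, F a b :=
    (Finset.add_sum_erase _ (fun a => ∑ b ∈ Finset.univ.erase a, F a b) (Finset.mem_univ i)).symm
  have h2 : ∀ a ∈ Finset.univ.erase i, ∑ b ∈ Finset.univ.erase a, F a b =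
      F a i + ∑ b ∈ (Finset.univ.erase a).erase i, F a b := by
    intro a ha
    have hia : i ∈ Finset.univ.erase a :=
      Finset.mem_erase.2 ⟨(Finset.mem_erase.1 ha).1.symm, Finset.mem_univ _⟩
    exact (Finset.add_sum_erase _ (fun b => F a b) hia).symm
  rw [h1, Finset.sum_congr rfl h2, Finset.sum_add_distrib]
  ring

/-! #### The jump rates and the flux measures -/

/-- The rate `e^{-β Σ_{j ≠ i} φ(w_j - z)}` of moving particle `i` of `w` to the point `z`
(BCDP 2006 §5: `e^{-β(H^{xz}(η) - H^{x-}(η))}` with `H^{xz} - H^{x-} = Σ_{y ∈ η∖x} φ(y - z)`).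
[cite: BoudouCaputoDaiPraPosta2006, §5 (5.2)] -/
def rate (i : Fin N) (z : Pt d) (w : Conf d N) : ℝ :=
  Real.exp (-(P.β * ∑ j, if j ≠ i then P.φ (w j - z) else 0))

/-- `0 < rate`. [folklore] -/
theorem rate_pos (i : Fin N) (z : Pt d) (w : Conf d N) : 0 < P.rate N i z w := Real.exp_pos _

/-- The interaction of the would-be-moved particle with the others is nonnegative. [folklore] -/
theorem sum_ite_ne_φ_nonneg (i : Fin N) (z : Pt d) (w : Conf d N) :
    0 ≤ ∑ j, if j ≠ i then P.φ (w j - z) else 0 :=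
  Finset.sum_nonneg fun j _ => by split_ifs; exacts [P.φ_nonneg _, le_rfl]

/-- `rate ≤ 1`. [folklore] -/
theorem rate_le_one (i : Fin N) (z : Pt d) (w : Conf d N) : P.rate N i z w ≤ 1 :=
  Real.exp_le_one_iff.2 (neg_nonpos.2 (mul_nonneg P.β_nonneg (P.sum_ite_ne_φ_nonneg N i z w)))

/-- `|rate| ≤ 1`. [folklore] -/
theorem norm_rate_le_one (i : Fin N) (z : Pt d) (w : Conf d N) : ‖P.rate N i z w‖ ≤ 1 := by
  rw [Real.norm_eq_abs, abs_of_pos (P.rate_pos N i z w)]; exact P.rate_le_one N i z w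

/-- The rate is jointly measurable in `(w, z)`. [folklore] -/
@[fun_prop]
theorem measurable_rate (i : Fin N) : Measurable fun p : Conf d N × Pt d => P.rate N i p.2 p.1 := by
  unfold rate
  refine (Measurable.const_mul (Finset.measurable_sum _ fun j _ => ?_) _).neg.exp
  split_ifs
  · exact P.measurable_φ.comp (((measurable_pi_apply j).comp measurable_fst).sub measurable_snd)
  · exact measurable_const

/-- The rate of moving particle `i` does not depend on the position of particle `i`. [folklore] -/
theorem rate_update (i : Fin N) (z v : Pt d) (w : Conf d N) :
    P.rate N i v (update w i z) = P.rate N i v w := by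
  unfold rate
  congr 3
  refine Finset.sum_congr rfl fun j _ => ?_
  split_ifs with h
  · rw [update_of_ne h]
  · rfl

/-- The energy of the pair `(w, z)` seen by the flux measure of particle `i`:
`W_i(w, z) = H(w) + Σ_{j ≠ i} φ(w_j - z)`. [folklore] -/
def pairW (i : Fin N) (p : Conf d N × Pt d) : ℝ :=
  P.H N p.1 + ∑ j, if j ≠ i then P.φ (p.1 j - p.2) else 0

/-- `W_i` is measurable. [folklore] -/
@[fun_prop]
theorem measurable_pairW (i : Fin N) : Measurable (P.pairW N i) := by
  unfold pairW
  refine ((P.measurable_H N).comp measurable_fst).add (Finset.measurable_sum _ fun j _ => ?_)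
  split_ifs
  · exact P.measurable_φ.comp (((measurable_pi_apply j).comp measurable_fst).sub measurable_snd)
  · exact measurable_const

/-- **Detailed balance**: `W_i` is invariant under the exchange of particle `i` with the extra
point (BCDP 2006 §5, proof of Lemma 5.1: "by the change of variables `w₁ ↦ z ↦ w₁`"). This is
where evenness of `φ` is used. [cite: BoudouCaputoDaiPraPosta2006, §5 Lemma 5.1] -/
theorem pairW_swapUpd (i : Fin N) (p : Conf d N × Pt d) :
    P.pairW N i (swapUpd i p) = P.pairW N i p := by
  obtain ⟨w, z⟩ := p
  have hsym : ∀ x y : Pt d, P.φ (x - y) = P.φ (y - x) := fun x y => by rw [← P.φ_even, neg_sub]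
  -- it suffices to compare the doubled energies
  suffices h : 2 * P.pairW N i (swapUpd i (w, z)) = 2 * P.pairW N i (w, z) by linarith
  simp only [pairW, swapUpd_fst, swapUpd_snd, mul_add, two_mul_H, sum_ite_ne]
  rw [sum_erase_split N (fun a b => P.φ (update w i z a - update w i z b)) i,
    sum_erase_split N (fun a b => P.φ (w a - w b)) i]
  simp only [update_self]
  -- the pairs avoiding `i` are untouched
  have hQ : ∑ a ∈ Finset.univ.erase i, ∑ b ∈ (Finset.univ.erase a).erase i,
      P.φ (update w i z a - update w i z b) =
      ∑ a ∈ Finset.univ.erase i, ∑ b ∈ (Finset.univ.erase a).erase i, P.φ (w a - w b) := by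
    refine Finset.sum_congr rfl fun a ha => Finset.sum_congr rfl fun b hb => ?_
    rw [update_of_ne (Finset.mem_erase.1 ha).1, update_of_ne (Finset.mem_erase.1 hb).1]
  have h1 : ∑ b ∈ Finset.univ.erase i, P.φ (z - update w i z b) =
      ∑ b ∈ Finset.univ.erase i, P.φ (w b - z) :=
    Finset.sum_congr rfl fun b hb => by rw [update_of_ne (Finset.mem_erase.1 hb).1, hsym]
  have h2 : ∑ a ∈ Finset.univ.erase i, P.φ (update w i z a - z) =
      ∑ a ∈ Finset.univ.erase i, P.φ (w a - z) :=
    Finset.sum_congr rfl fun a ha => by rw [update_of_ne (Finset.mem_erase.1 ha).1]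
  have h3 : ∑ a ∈ Finset.univ.erase i, P.φ (update w i z a - w i) =
      ∑ a ∈ Finset.univ.erase i, P.φ (w a - w i) :=
    Finset.sum_congr rfl fun a ha => by rw [update_of_ne (Finset.mem_erase.1 ha).1]
  have h4 : ∑ b ∈ Finset.univ.erase i, P.φ (w i - w b) = ∑ b ∈ Finset.univ.erase i, P.φ (w b - w i) :=
    Finset.sum_congr rfl fun b _ => hsym _ _
  rw [hQ, h1, h2, h3, h4]
  ring

/-- The flux measure of particle `i`: `R_i(dw, dz) = ν(dw) · e^{-β Σ_{j≠i} φ(w_j - z)} dz|_Λ` on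
`Λ^N × Λ` (the measure `ν(dη) c(η, dγ)` of BCDP 2006 §2 for the moves of particle `i`).
[cite: BoudouCaputoDaiPraPosta2006, §2 and §5] -/
def R (i : Fin N) : Measure (Conf d N × Pt d) :=
  ((P.ν N).prod P.μ₀).withDensity fun p => ENNReal.ofReal (P.rate N i p.2 p.1)

/-- The density `Z⁻¹ e^{-β W_i}` of `R_i` with respect to `dw dz`. [folklore] -/
def Rdens (i : Fin N) (p : Conf d N × Pt d) : ℝ := (P.Z N)⁻¹ * Real.exp (-(P.β * P.pairW N i p))

/-- `0 < Z⁻¹ e^{-βW_i}`. [folklore] -/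
theorem Rdens_pos (i : Fin N) (p : Conf d N × Pt d) : 0 < P.Rdens N i p :=
  mul_pos (inv_pos.2 (P.Z_pos N)) (Real.exp_pos _)

/-- `Z⁻¹ e^{-βW_i}` is measurable. [folklore] -/
@[fun_prop]
theorem measurable_Rdens (i : Fin N) : Measurable (P.Rdens N i) := by unfold Rdens; fun_prop

/-- `Z⁻¹ e^{-βH(w)} · rate_i(z, w) = Z⁻¹ e^{-β W_i(w, z)}`. [folklore] -/
theorem dens_mul_rate (i : Fin N) (p : Conf d N × Pt d) :
    P.dens N p.1 * P.rate N i p.2 p.1 = P.Rdens N i p := by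
  simp only [dens, rate, Rdens, wt, pairW, mul_assoc, ← Real.exp_add]
  congr 2
  ring

/-- `R_i = Z⁻¹ e^{-β W_i} dw dz`. [folklore] -/
theorem R_eq_withDensity (i : Fin N) :
    P.R N i = ((P.ref N).prod P.μ₀).withDensity fun p => ENNReal.ofReal (P.Rdens N i p) := by
  have hdf : Measurable fun z : Conf d N × Pt d => ENNReal.ofReal (P.dens N z.1) :=
    (P.measurable_dens N).ennreal_ofReal.comp measurable_fst
  have hrg : Measurable fun p : Conf d N × Pt d => ENNReal.ofReal (P.rate N i p.2 p.1) :=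
    (P.measurable_rate N i).ennreal_ofReal
  rw [R, ν_eq_withDensity, prod_withDensity_left (P.measurable_dens N).ennreal_ofReal,
    ← withDensity_mul _ hdf hrg]
  congr 1
  funext p
  simp only [Pi.mul_apply]
  rw [← ENNReal.ofReal_mul (P.dens_pos N _).le, dens_mul_rate]

/-- `Z⁻¹ e^{-βW_i}` is exchange invariant. [folklore] -/
theorem Rdens_swapUpd (i : Fin N) (p : Conf d N × Pt d) :
    P.Rdens N i (swapUpd i p) = P.Rdens N i p := by
  rw [Rdens, Rdens, pairW_swapUpd]

/-- A measure-preserving measurable equivalence intertwining two densities intertwines the weighted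
measures (used with `ρ' = ρ`: an invariant density gives an invariant weighted measure). [folklore] -/
theorem _root_.MeasureTheory.MeasurePreserving.withDensity_congr {X : Type*} [MeasurableSpace X]
    {μ : Measure X} (T : X ≃ᵐ X) (hT : MeasurePreserving T μ μ) {ρ ρ' : X → ℝ≥0∞}
    (hρT : ∀ x, ρ (T x) = ρ' x) : MeasurePreserving T (μ.withDensity ρ') (μ.withDensity ρ) := by
  refine ⟨T.measurable, Measure.ext fun s hs => ?_⟩
  rw [Measure.map_apply T.measurable hs, withDensity_apply _ (T.measurable hs), withDensity_apply _ hs,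
    ← hT.setLIntegral_comp_preimage_emb T.measurableEmbedding ρ s]
  exact lintegral_congr fun x => (hρT x).symm

/-- **Reversibility of the move-one-particle dynamics**: the exchange `(w, z) ↦ (w^{i→z}, wᵢ)`
preserves the flux measure `R_i` (BCDP 2006 §5: "it is easy to show that the reversibility
condition (db) holds"). [cite: BoudouCaputoDaiPraPosta2006, §5] -/
theorem measurePreserving_swapUpd_R (i : Fin N) :
    MeasurePreserving (swapUpd i) (P.R N i) (P.R N i) := by
  rw [R_eq_withDensity]
  exact (measurePreserving_swapUpd P.μ₀ i).withDensity_congr (swapUpdEquiv i)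
    (ρ := fun p => ENNReal.ofReal (P.Rdens N i p)) (ρ' := fun p => ENNReal.ofReal (P.Rdens N i p))
    fun p => by simp only [coe_swapUpdEquiv, Rdens_swapUpd]

/-- `R_i` is a finite measure (total mass `≤ |Λ|`). [folklore] -/
instance (i : Fin N) : IsFiniteMeasure (P.R N i) := by
  refine ⟨?_⟩
  rw [R, withDensity_apply _ MeasurableSet.univ, Measure.restrict_univ]
  calc ∫⁻ p, ENNReal.ofReal (P.rate N i p.2 p.1) ∂(P.ν N).prod P.μ₀
      ≤ ∫⁻ _, 1 ∂(P.ν N).prod P.μ₀ :=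
        lintegral_mono fun p => ENNReal.ofReal_le_one.2 (P.rate_le_one N i _ _)
    _ < ∞ := by rw [lintegral_one]; exact measure_lt_top _ _

/-- `R_i ≪ ν ⊗ dz`. [folklore] -/
theorem R_absolutelyContinuous (i : Fin N) : P.R N i ≪ (P.ν N).prod P.μ₀ :=
  withDensity_absolutelyContinuous _ _

/-- `ν ⊗ dz ≪ R_i` (the rates are positive: `φ < ∞`). [folklore] -/
theorem prod_absolutelyContinuous_R (i : Fin N) : (P.ν N).prod P.μ₀ ≪ P.R N i :=
  withDensity_absolutelyContinuous' (P.measurable_rate N i).ennreal_ofReal.aemeasurable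
    (Eventually.of_forall fun _ => (ENNReal.ofReal_pos.2 (P.rate_pos N i _ _)).ne')

/-- `ν ⊗ dz` and `dw ⊗ dz` have the same null sets. [folklore] -/
theorem prod_absolutelyContinuous_refProd : (P.ν N).prod P.μ₀ ≪ (P.ref N).prod P.μ₀ :=
  Measure.AbsolutelyContinuous.prod (P.ν_absolutelyContinuous N) Measure.AbsolutelyContinuous.rfl

/-- `dw ⊗ dz ≪ ν ⊗ dz`. [folklore] -/
theorem refProd_absolutelyContinuous_prod : (P.ref N).prod P.μ₀ ≪ (P.ν N).prod P.μ₀ :=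
  Measure.AbsolutelyContinuous.prod (P.ref_absolutelyContinuous_ν N) Measure.AbsolutelyContinuous.rfl

/-- Integration against `R_i`: `∫ F dR_i = ∫∫ rate_i(z, w) F(w, z) dz ν(dw)` (product form). [folklore] -/
theorem integral_R {E : Type*} [NormedAddCommGroup E] [NormedSpace ℝ E] (i : Fin N)
    (F : Conf d N × Pt d → E) :
    ∫ p, F p ∂P.R N i = ∫ p, P.rate N i p.2 p.1 • F p ∂(P.ν N).prod P.μ₀ := by
  rw [R, integral_withDensity_eq_integral_toReal_smul (P.measurable_rate N i).ennreal_ofReal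
    (Eventually.of_forall fun _ => ENNReal.ofReal_lt_top)]
  refine integral_congr_ae (Eventually.of_forall fun p => ?_)
  dsimp only
  rw [ENNReal.toReal_ofReal (P.rate_pos N i _ _).le]

/-- Change of variables by the exchange map in `R_i`-integrals. [folklore] -/
theorem integral_comp_swapUpd {E : Type*} [NormedAddCommGroup E] [NormedSpace ℝ E] (i : Fin N)
    (F : Conf d N × Pt d → E) :
    ∫ p, F (swapUpd i p) ∂P.R N i = ∫ p, F p ∂P.R N i :=
  (P.measurePreserving_swapUpd_R N i).integral_comp (swapUpdEquiv i).measurableEmbedding F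

/-- Change of variables by the exchange map in `R_i`-lintegrals. [folklore] -/
theorem lintegral_comp_swapUpd (i : Fin N) (F : Conf d N × Pt d → ℝ≥0∞) :
    ∫⁻ p, F (swapUpd i p) ∂P.R N i = ∫⁻ p, F p ∂P.R N i :=
  (P.measurePreserving_swapUpd_R N i).lintegral_comp_emb (swapUpdEquiv i).measurableEmbedding F

/-- `(w, z) ↦ w` is quasi-measure-preserving `R_i → ν`. [folklore] -/
theorem quasiMeasurePreserving_fst (i : Fin N) :
    Measure.QuasiMeasurePreserving Prod.fst (P.R N i) (P.ν N) :=
  Measure.quasiMeasurePreserving_fst.mono_left (P.R_absolutelyContinuous N i)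

/-- `(w, z) ↦ w^{i→z}` is quasi-measure-preserving `R_i → ν` (reversibility). [folklore] -/
theorem quasiMeasurePreserving_upd (i : Fin N) :
    Measure.QuasiMeasurePreserving (fun p : Conf d N × Pt d => update p.1 i p.2) (P.R N i) (P.ν N) :=
  (P.quasiMeasurePreserving_fst N i).comp (P.measurePreserving_swapUpd_R N i).quasiMeasurePreserving


end GasModel

/-! ### The Dirichlet form as a bounded bilinear form on `L²(ν)` -/

section Form

variable {d N : ℕ}

/-- The increment of `f` along the move of particle `i` to `z`:
`∇̃_{i z} f (w) = f(w) - f(w^{i→z})` (the paper's `-∇_{xz} f`). [folklore] -/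
def mgrad (i : Fin N) (f : Conf d N → ℝ) (p : Conf d N × Pt d) : ℝ := f p.1 - f (update p.1 i p.2)

/-- Unfolding of `mgrad`. [folklore] -/
theorem mgrad_apply (i : Fin N) (f : Conf d N → ℝ) (p : Conf d N × Pt d) :
    mgrad i f p = f p.1 - f (update p.1 i p.2) := rfl

/-- The increment is odd under the exchange map: `∇̃f (w^{i→z}, wᵢ) = -∇̃f (w, z)`. [folklore] -/
theorem mgrad_swapUpd (i : Fin N) (f : Conf d N → ℝ) (p : Conf d N × Pt d) :
    mgrad i f (swapUpd i p) = -mgrad i f p := by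
  simp only [mgrad, swapUpd_fst, swapUpd_snd, update_idem, update_eq_self, neg_sub]

/-- `∇̃(f + g) = ∇̃f + ∇̃g`. [folklore] -/
theorem mgrad_add (i : Fin N) (f g : Conf d N → ℝ) (p : Conf d N × Pt d) :
    mgrad i (f + g) p = mgrad i f p + mgrad i g p := by
  simp only [mgrad, Pi.add_apply]; ring

/-- `∇̃(c f) = c ∇̃f`. [folklore] -/
theorem mgrad_const_mul (i : Fin N) (c : ℝ) (f : Conf d N → ℝ) (p : Conf d N × Pt d) :
    mgrad i (fun w => c * f w) p = c * mgrad i f p := by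
  simp only [mgrad]; ring

/-- Constants have zero increment: `∇̃(f - m) = ∇̃f`. [folklore] -/
theorem mgrad_sub_const (i : Fin N) (f : Conf d N → ℝ) (m : ℝ) (p : Conf d N × Pt d) :
    mgrad i (fun w => f w - m) p = mgrad i f p := by
  simp only [mgrad]; ring

/-- `|∫ F G| ≤ ‖F‖₂ ‖G‖₂` (Cauchy–Schwarz in `L²`). [folklore] -/
theorem abs_integral_mul_le_of_memLp_two {X : Type*} [MeasurableSpace X] {μ : Measure X}
    {F G : X → ℝ} (hF : MemLp F 2 μ) (hG : MemLp G 2 μ) :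
    |∫ x, F x * G x ∂μ| ≤ (eLpNorm F 2 μ).toReal * (eLpNorm G 2 μ).toReal := by
  have h : ∫ x, F x * G x ∂μ = ⟪hG.toLp G, hF.toLp F⟫_ℝ := by
    rw [L2.inner_def]
    refine integral_congr_ae ?_
    filter_upwards [hF.coeFn_toLp, hG.coeFn_toLp] with x hx hy
    rw [hx, hy, real_inner_eq_re_inner, RCLike.inner_apply, conj_trivial, RCLike.re_to_real]
  rw [h, mul_comm]
  calc |⟪hG.toLp G, hF.toLp F⟫_ℝ| ≤ ‖hG.toLp G‖ * ‖hF.toLp F‖ := abs_real_inner_le_norm _ _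
    _ = _ := by rw [Lp.norm_toLp, Lp.norm_toLp]

namespace GasModel

variable (P : GasModel d) (N)

/-- `R_i ≤ ν ⊗ dz` (the rates are at most `1`). [folklore] -/
theorem R_le_prod (i : Fin N) : P.R N i ≤ (P.ν N).prod P.μ₀ := by
  calc P.R N i ≤ ((P.ν N).prod P.μ₀).withDensity 1 :=
        withDensity_mono (Eventually.of_forall fun p => ENNReal.ofReal_le_one.2 (P.rate_le_one N i _ _))
    _ = (P.ν N).prod P.μ₀ := withDensity_one

/-- `‖f ∘ fst‖_{L²(ν ⊗ dz)} = |Λ|^{1/2} ‖f‖_{L²(ν)}`. [folklore] -/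
theorem eLpNorm_comp_fst_prod {f : Conf d N → ℝ} (hf : AEStronglyMeasurable f (P.ν N)) :
    eLpNorm (fun p : Conf d N × Pt d => f p.1) 2 ((P.ν N).prod P.μ₀) =
      volume P.Λ ^ (1 / 2 : ℝ) * eLpNorm f 2 (P.ν N) := by
  have hmap : Measure.map Prod.fst ((P.ν N).prod P.μ₀) = (volume P.Λ) • P.ν N := by
    rw [Measure.map_fst_prod, μ₀_univ]
  have hf' : AEStronglyMeasurable f (Measure.map Prod.fst ((P.ν N).prod P.μ₀)) := by
    rw [hmap]; exact hf.smul_measure _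
  have h := eLpNorm_map_measure (p := 2) hf' measurable_fst.aemeasurable
  rw [hmap, eLpNorm_smul_measure_of_ne_top ENNReal.ofNat_ne_top] at h
  rw [show (fun p : Conf d N × Pt d => f p.1) = f ∘ Prod.fst from rfl, ← h, smul_eq_mul]
  norm_num

/-- `‖f ∘ fst‖_{L²(R_i)} ≤ |Λ|^{1/2} ‖f‖_{L²(ν)}`. [folklore] -/
theorem eLpNorm_comp_fst_R_le (i : Fin N) {f : Conf d N → ℝ} (hf : AEStronglyMeasurable f (P.ν N)) :
    eLpNorm (fun p : Conf d N × Pt d => f p.1) 2 (P.R N i) ≤ volume P.Λ ^ (1 / 2 : ℝ) * eLpNorm f 2 (P.ν N) :=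
  (eLpNorm_mono_measure _ (P.R_le_prod N i)).trans (P.eLpNorm_comp_fst_prod N hf).le

/-- `f ∘ fst` is a.e.-strongly measurable for `R_i`. [folklore] -/
theorem aestronglyMeasurable_comp_fst_R (i : Fin N) {f : Conf d N → ℝ}
    (hf : AEStronglyMeasurable f (P.ν N)) :
    AEStronglyMeasurable (fun p : Conf d N × Pt d => f p.1) (P.R N i) :=
  (hf.comp_fst).mono_ac (P.R_absolutelyContinuous N i)

/-- `f(w^{i→z})` is a.e.-strongly measurable for `R_i`. [folklore] -/
theorem aestronglyMeasurable_comp_upd_R (i : Fin N) {f : Conf d N → ℝ}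
    (hf : AEStronglyMeasurable f (P.ν N)) :
    AEStronglyMeasurable (fun p : Conf d N × Pt d => f (update p.1 i p.2)) (P.R N i) := by
  have h := (P.aestronglyMeasurable_comp_fst_R N i hf).comp_measurePreserving (P.measurePreserving_swapUpd_R N i)
  exact h

/-- By reversibility `‖f(w^{i→z})‖_{L²(R_i)} = ‖f(w)‖_{L²(R_i)}`. [folklore] -/
theorem eLpNorm_comp_upd_R (i : Fin N) {f : Conf d N → ℝ} (hf : AEStronglyMeasurable f (P.ν N)) :
    eLpNorm (fun p : Conf d N × Pt d => f (update p.1 i p.2)) 2 (P.R N i) =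
      eLpNorm (fun p : Conf d N × Pt d => f p.1) 2 (P.R N i) := by
  have h := eLpNorm_comp_measurePreserving (p := 2) (P.aestronglyMeasurable_comp_fst_R N i hf)
    (P.measurePreserving_swapUpd_R N i)
  exact h

/-- `f ∘ fst ∈ L²(R_i)` for `f ∈ L²(ν)`. [folklore] -/
theorem memLp_comp_fst_R (i : Fin N) {f : Conf d N → ℝ} (hf : MemLp f 2 (P.ν N)) :
    MemLp (fun p : Conf d N × Pt d => f p.1) 2 (P.R N i) :=
  (hf.comp_fst P.μ₀).mono_measure (P.R_le_prod N i)

/-- `f(w^{i→z}) ∈ L²(R_i)` for `f ∈ L²(ν)`. [folklore] -/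
theorem memLp_comp_upd_R (i : Fin N) {f : Conf d N → ℝ} (hf : MemLp f 2 (P.ν N)) :
    MemLp (fun p : Conf d N × Pt d => f (update p.1 i p.2)) 2 (P.R N i) := by
  have h := (P.memLp_comp_fst_R N i hf).comp_measurePreserving (P.measurePreserving_swapUpd_R N i)
  exact h

/-- `∇̃_i f ∈ L²(R_i)` for `f ∈ L²(ν)`. [folklore] -/
theorem memLp_mgrad (i : Fin N) {f : Conf d N → ℝ} (hf : MemLp f 2 (P.ν N)) :
    MemLp (mgrad i f) 2 (P.R N i) :=
  (P.memLp_comp_fst_R N i hf).sub (P.memLp_comp_upd_R N i hf)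

/-- `‖∇̃_i f‖_{L²(R_i)} ≤ 2 |Λ|^{1/2} ‖f‖_{L²(ν)}`. [folklore] -/
theorem eLpNorm_mgrad_le (i : Fin N) {f : Conf d N → ℝ} (hf : MemLp f 2 (P.ν N)) :
    eLpNorm (mgrad i f) 2 (P.R N i) ≤ 2 * (volume P.Λ ^ (1 / 2 : ℝ) * eLpNorm f 2 (P.ν N)) := by
  have h1 := P.eLpNorm_comp_fst_R_le N i hf.1
  have h2 := P.eLpNorm_comp_upd_R N i hf.1
  calc eLpNorm (mgrad i f) 2 (P.R N i)
      ≤ eLpNorm (fun p : Conf d N × Pt d => f p.1) 2 (P.R N i) +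
          eLpNorm (fun p : Conf d N × Pt d => f (update p.1 i p.2)) 2 (P.R N i) :=
        eLpNorm_sub_le (P.aestronglyMeasurable_comp_fst_R N i hf.1)
          (P.aestronglyMeasurable_comp_upd_R N i hf.1) one_le_two
    _ ≤ _ := by rw [h2, two_mul]; exact add_le_add h1 h1

/-- The `L²(ν)`-norm of a representative, as a real number. [folklore] -/
def l2norm (f : Conf d N → ℝ) : ℝ := (eLpNorm f 2 (P.ν N)).toReal

/-- `0 ≤ ‖f‖`. [folklore] -/
theorem l2norm_nonneg (f : Conf d N → ℝ) : 0 ≤ P.l2norm N f := ENNReal.toReal_nonneg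

/-- `(|Λ|^{1/2}).toReal² = |Λ|`. [folklore] -/
theorem toReal_sqrt_volume_mul_self :
    (volume P.Λ ^ (1 / 2 : ℝ)).toReal * (volume P.Λ ^ (1 / 2 : ℝ)).toReal = P.vol := by
  rw [← ENNReal.toReal_mul, ← ENNReal.rpow_add_of_nonneg _ _ (by norm_num) (by norm_num)]
  norm_num [vol]

/-- `‖∇̃_i f‖_{L²(R_i)}` as a real number is at most `2 |Λ|^{1/2} ‖f‖`. [folklore] -/
theorem toReal_eLpNorm_mgrad_le (i : Fin N) {f : Conf d N → ℝ} (hf : MemLp f 2 (P.ν N)) :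
    (eLpNorm (mgrad i f) 2 (P.R N i)).toReal ≤ 2 * (volume P.Λ ^ (1 / 2 : ℝ)).toReal * P.l2norm N f := by
  have h := P.eLpNorm_mgrad_le N i hf
  have hfin : 2 * (volume P.Λ ^ (1 / 2 : ℝ) * eLpNorm f 2 (P.ν N)) ≠ ∞ :=
    ENNReal.mul_ne_top ENNReal.ofNat_ne_top (ENNReal.mul_ne_top
      (ENNReal.rpow_ne_top_of_nonneg (by norm_num) P.volume_Λ_lt_top.ne) hf.eLpNorm_ne_top)
  have := ENNReal.toReal_mono hfin h
  rw [ENNReal.toReal_mul, ENNReal.toReal_mul, ENNReal.toReal_ofNat] at this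
  rw [l2norm, mul_assoc]
  exact this

/-- The `i`-th term of the Dirichlet form on representatives:
`ℰ_i(f, g) = ∫ ∇̃_i f ∇̃_i g dR_i = ∫∫ ν(dw) dz e^{-βΣ_{j≠i}φ(w_j-z)} (f(w)-f(w^{i→z}))(g(w)-g(w^{i→z}))`.
[cite: BoudouCaputoDaiPraPosta2006, §5 (5.3)] -/
def formᵢ (i : Fin N) (f g : Conf d N → ℝ) : ℝ := ∫ p, mgrad i f p * mgrad i g p ∂P.R N i

/-- **The Dirichlet form** of the move-one-particle dynamics on representatives,
`ℰ(f, g) = Σ_i |Λ|⁻¹/2 · ℰ_i(f, g)` (BCDP 2006 §5 (5.3):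
`ℰ(f,f) = ½ ∫_Λ dz/|Λ| ν[Σ_{x∈η} e^{-β(H^{xz}-H^{x-})} (∇_{xz} f)²]`).
[cite: BoudouCaputoDaiPraPosta2006, §5 (5.3)] -/
def form (f g : Conf d N → ℝ) : ℝ := ∑ i, P.vol⁻¹ / 2 * P.formᵢ N i f g

/-- `ℰ_i` is symmetric. [folklore] -/
theorem formᵢ_comm (i : Fin N) (f g : Conf d N → ℝ) : P.formᵢ N i f g = P.formᵢ N i g f := by
  simp only [formᵢ, mul_comm]

/-- `ℰ` is symmetric. [folklore] -/
theorem form_comm (f g : Conf d N → ℝ) : P.form N f g = P.form N g f := by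
  simp only [form, P.formᵢ_comm N _ f]

/-- `0 ≤ ℰ_i(f, f)`. [folklore] -/
theorem formᵢ_self_nonneg (i : Fin N) (f : Conf d N → ℝ) : 0 ≤ P.formᵢ N i f f :=
  integral_nonneg fun _ => mul_self_nonneg _

/-- `0 ≤ ℰ(f, f)`. [folklore] -/
theorem form_self_nonneg (f : Conf d N → ℝ) : 0 ≤ P.form N f f :=
  Finset.sum_nonneg fun i _ => mul_nonneg (div_nonneg (inv_nonneg.2 P.vol_pos.le) zero_le_two)
    (P.formᵢ_self_nonneg N i f)

/-- `ℰ_i` only depends on the `ν`-a.e. classes of its arguments (reversibility makes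
`(w, z) ↦ w^{i→z}` quasi-measure-preserving). [folklore] -/
theorem formᵢ_congr_ae (i : Fin N) {f f' g g' : Conf d N → ℝ} (hf : f =ᵐ[P.ν N] f')
    (hg : g =ᵐ[P.ν N] g') : P.formᵢ N i f g = P.formᵢ N i f' g' := by
  refine integral_congr_ae ?_
  filter_upwards [(P.quasiMeasurePreserving_fst N i).ae_eq_comp hf,
    (P.quasiMeasurePreserving_fst N i).ae_eq_comp hg,
    (P.quasiMeasurePreserving_upd N i).ae_eq_comp hf,
    (P.quasiMeasurePreserving_upd N i).ae_eq_comp hg] with p h1 h2 h3 h4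
  simp only [Function.comp_apply] at h1 h2 h3 h4
  simp only [mgrad, h1, h2, h3, h4]

/-- `ℰ` only depends on the `ν`-a.e. classes of its arguments. [folklore] -/
theorem form_congr_ae {f f' g g' : Conf d N → ℝ} (hf : f =ᵐ[P.ν N] f') (hg : g =ᵐ[P.ν N] g') :
    P.form N f g = P.form N f' g' := by
  simp only [form, P.formᵢ_congr_ae N _ hf hg]

/-- The integrand of `ℰ_i` is integrable for `L²(ν)` arguments. [folklore] -/
theorem integrable_mgrad_mul (i : Fin N) {f g : Conf d N → ℝ} (hf : MemLp f 2 (P.ν N))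
    (hg : MemLp g 2 (P.ν N)) : Integrable (fun p => mgrad i f p * mgrad i g p) (P.R N i) :=
  (P.memLp_mgrad N i hf).integrable_mul (P.memLp_mgrad N i hg)

/-- `ℰ_i(f₁ + f₂, g) = ℰ_i(f₁, g) + ℰ_i(f₂, g)` on `L²(ν)`. [folklore] -/
theorem formᵢ_add_left (i : Fin N) {f₁ f₂ g : Conf d N → ℝ} (h₁ : MemLp f₁ 2 (P.ν N))
    (h₂ : MemLp f₂ 2 (P.ν N)) (hg : MemLp g 2 (P.ν N)) :
    P.formᵢ N i (f₁ + f₂) g = P.formᵢ N i f₁ g + P.formᵢ N i f₂ g := by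
  rw [formᵢ, formᵢ, formᵢ, ← integral_add (P.integrable_mgrad_mul N i h₁ hg)
    (P.integrable_mgrad_mul N i h₂ hg)]
  refine integral_congr_ae (Eventually.of_forall fun p => ?_)
  simp only [mgrad_add]; ring

/-- `ℰ_i(c f, g) = c ℰ_i(f, g)`. [folklore] -/
theorem formᵢ_const_mul_left (i : Fin N) (c : ℝ) (f g : Conf d N → ℝ) :
    P.formᵢ N i (fun w => c * f w) g = c * P.formᵢ N i f g := by
  rw [formᵢ, formᵢ, ← integral_const_mul]
  refine integral_congr_ae (Eventually.of_forall fun p => ?_)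
  simp only [mgrad_const_mul]; ring

/-- **Boundedness of `ℰ_i` on `L²(ν)`**: `|ℰ_i(f, g)| ≤ 4 |Λ| ‖f‖ ‖g‖`. [folklore] -/
theorem abs_formᵢ_le (i : Fin N) {f g : Conf d N → ℝ} (hf : MemLp f 2 (P.ν N))
    (hg : MemLp g 2 (P.ν N)) :
    |P.formᵢ N i f g| ≤ 4 * P.vol * P.l2norm N f * P.l2norm N g := by
  have h := abs_integral_mul_le_of_memLp_two (P.memLp_mgrad N i hf) (P.memLp_mgrad N i hg)
  have hf' := P.toReal_eLpNorm_mgrad_le N i hf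
  have hg' := P.toReal_eLpNorm_mgrad_le N i hg
  have hsv := P.toReal_sqrt_volume_mul_self
  rw [formᵢ]
  calc |∫ p, mgrad i f p * mgrad i g p ∂P.R N i|
      ≤ (eLpNorm (mgrad i f) 2 (P.R N i)).toReal * (eLpNorm (mgrad i g) 2 (P.R N i)).toReal := h
    _ ≤ (2 * (volume P.Λ ^ (1 / 2 : ℝ)).toReal * P.l2norm N f) *
          (2 * (volume P.Λ ^ (1 / 2 : ℝ)).toReal * P.l2norm N g) :=
        mul_le_mul hf' hg' ENNReal.toReal_nonneg
          (mul_nonneg (mul_nonneg zero_le_two ENNReal.toReal_nonneg) (P.l2norm_nonneg N f))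
    _ = 4 * ((volume P.Λ ^ (1 / 2 : ℝ)).toReal * (volume P.Λ ^ (1 / 2 : ℝ)).toReal) *
          P.l2norm N f * P.l2norm N g := by ring
    _ = _ := by rw [hsv]

/-- **Boundedness of `ℰ` on `L²(ν)`**: `|ℰ(f, g)| ≤ 2N ‖f‖ ‖g‖` (the generator is bounded: all
rates are at most `1`). [folklore] -/
theorem abs_form_le {f g : Conf d N → ℝ} (hf : MemLp f 2 (P.ν N)) (hg : MemLp g 2 (P.ν N)) :
    |P.form N f g| ≤ 2 * N * (P.l2norm N f * P.l2norm N g) := by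
  rw [form]
  calc |∑ i, P.vol⁻¹ / 2 * P.formᵢ N i f g| ≤ ∑ i, |P.vol⁻¹ / 2 * P.formᵢ N i f g| :=
        Finset.abs_sum_le_sum_abs _ _
    _ ≤ ∑ _i : Fin N, 2 * (P.l2norm N f * P.l2norm N g) := by
        refine Finset.sum_le_sum fun i _ => ?_
        rw [abs_mul, abs_of_nonneg (div_nonneg (inv_nonneg.2 P.vol_pos.le) zero_le_two)]
        calc P.vol⁻¹ / 2 * |P.formᵢ N i f g| ≤ P.vol⁻¹ / 2 * (4 * P.vol * P.l2norm N f * P.l2norm N g) :=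
              mul_le_mul_of_nonneg_left (P.abs_formᵢ_le N i hf hg)
                (div_nonneg (inv_nonneg.2 P.vol_pos.le) zero_le_two)
          _ = 2 * (P.l2norm N f * P.l2norm N g) := by field_simp [P.vol_pos.ne']; ring
    _ = _ := by rw [Finset.sum_const, Finset.card_univ, Fintype.card_fin, nsmul_eq_mul]; ring

/-! #### The form on `L²(ν)` and the generator (Riesz representation) -/

/-- The Dirichlet form read on `L²(ν)` through representatives. [folklore] -/
def formLp (x y : Lp ℝ 2 (P.ν N)) : ℝ := P.form N x y

/-- `formLp` is symmetric. [folklore] -/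
theorem formLp_comm (x y : Lp ℝ 2 (P.ν N)) : P.formLp N x y = P.formLp N y x := P.form_comm N _ _

/-- `|formLp x y| ≤ 2N ‖x‖ ‖y‖`. [folklore] -/
theorem abs_formLp_le (x y : Lp ℝ 2 (P.ν N)) : |P.formLp N x y| ≤ 2 * N * (‖x‖ * ‖y‖) := by
  rw [formLp, Lp.norm_def, Lp.norm_def]
  exact P.abs_form_le N (Lp.memLp x) (Lp.memLp y)

/-- Additivity of `formLp` in the first slot. [folklore] -/
theorem formLp_add_left (x₁ x₂ y : Lp ℝ 2 (P.ν N)) :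
    P.formLp N (x₁ + x₂) y = P.formLp N x₁ y + P.formLp N x₂ y := by
  simp only [formLp]
  rw [P.form_congr_ae N (Lp.coeFn_add x₁ x₂) EventuallyEq.rfl, form, form, form, ← Finset.sum_add_distrib]
  refine Finset.sum_congr rfl fun i _ => ?_
  rw [P.formᵢ_add_left N i (Lp.memLp x₁) (Lp.memLp x₂) (Lp.memLp y)]
  ring

/-- Homogeneity of `formLp` in the first slot. [folklore] -/
theorem formLp_smul_left (c : ℝ) (x y : Lp ℝ 2 (P.ν N)) :
    P.formLp N (c • x) y = c * P.formLp N x y := by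
  simp only [formLp]
  rw [P.form_congr_ae N (Lp.coeFn_smul c x) EventuallyEq.rfl, form, form, Finset.mul_sum]
  refine Finset.sum_congr rfl fun i _ => ?_
  rw [show ((c • (x : Conf d N → ℝ)) : Conf d N → ℝ) = fun w => c * (x : Conf d N → ℝ) w from rfl,
    P.formᵢ_const_mul_left N i]
  ring

/-- Additivity of `formLp` in the second slot. [folklore] -/
theorem formLp_add_right (x y₁ y₂ : Lp ℝ 2 (P.ν N)) :
    P.formLp N x (y₁ + y₂) = P.formLp N x y₁ + P.formLp N x y₂ := by
  rw [formLp_comm, formLp_add_left, formLp_comm, P.formLp_comm N y₂]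

/-- Homogeneity of `formLp` in the second slot. [folklore] -/
theorem formLp_smul_right (c : ℝ) (x y : Lp ℝ 2 (P.ν N)) :
    P.formLp N x (c • y) = c * P.formLp N x y := by
  rw [formLp_comm, formLp_smul_left, formLp_comm]

/-- **`ℰ` as a continuous bilinear form on `L²(ν)`.** [folklore] -/
def formBilin : Lp ℝ 2 (P.ν N) →L[ℝ] Lp ℝ 2 (P.ν N) →L[ℝ] ℝ :=
  LinearMap.mkContinuous₂
    (LinearMap.mk₂ ℝ (P.formLp N) (P.formLp_add_left N) (P.formLp_smul_left N)
      (P.formLp_add_right N) (P.formLp_smul_right N))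
    (2 * N) fun x y => by
      rw [Real.norm_eq_abs, mul_assoc]
      exact P.abs_formLp_le N x y

/-- Evaluation of `formBilin`. [folklore] -/
@[simp]
theorem formBilin_apply (x y : Lp ℝ 2 (P.ν N)) : P.formBilin N x y = P.form N x y := rfl

/-- **The (negative) generator `A = -𝓛`** of the move-one-particle dynamics as a bounded operator
on `L²(ν)`, obtained from the Dirichlet form by the Riesz representation: `⟪A x, y⟫ = ℰ(x, y)`
(BCDP 2006 §5: "`𝓛` has a domain of self-adjointness in `L²(ν_Λ^N)`"; here `𝓛` is bounded since
the rates are bounded). [cite: BoudouCaputoDaiPraPosta2006, §5] -/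
def genOp : Lp ℝ 2 (P.ν N) →L[ℝ] Lp ℝ 2 (P.ν N) :=
  InnerProductSpace.continuousLinearMapOfBilin (𝕜 := ℝ) (P.formBilin N)

/-- `⟪A x, y⟫ = ℰ(x, y)`. [folklore] -/
theorem inner_genOp (x y : Lp ℝ 2 (P.ν N)) : ⟪P.genOp N x, y⟫_ℝ = P.form N x y := by
  rw [genOp, InnerProductSpace.continuousLinearMapOfBilin_apply, formBilin_apply]

/-- `A` is symmetric. [folklore] -/
theorem inner_genOp_comm (x y : Lp ℝ 2 (P.ν N)) : ⟪P.genOp N x, y⟫_ℝ = ⟪x, P.genOp N y⟫_ℝ := by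
  rw [real_inner_comm (P.genOp N y) x, inner_genOp, inner_genOp, form_comm]

/-- `A` is nonnegative: `⟪A x, x⟫ = ℰ(x, x) ≥ 0`. [folklore] -/
theorem inner_genOp_self_nonneg (x : Lp ℝ 2 (P.ν N)) : 0 ≤ ⟪P.genOp N x, x⟫_ℝ := by
  rw [inner_genOp]; exact P.form_self_nonneg N _

end GasModel

end Form

/-! ### The generator on bounded measurable functions -/

section Generator

variable {d N : ℕ}

/-- A bounded measurable function on a finite measure space is integrable. [folklore] -/
theorem integrable_of_bdd {X : Type*} [MeasurableSpace X] {μ : Measure X} [IsFiniteMeasure μ]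
    {F : X → ℝ} (hF : Measurable F) (C : ℝ) (hC : ∀ x, |F x| ≤ C) : Integrable F μ :=
  (integrable_const C).mono' hF.aestronglyMeasurable
    (Eventually.of_forall fun x => by rw [Real.norm_eq_abs]; exact hC x)

/-- Two vectors with the same inner products against a dense set are equal. [folklore] -/
theorem eq_of_inner_eq_on_dense {E : Type*} [NormedAddCommGroup E] [InnerProductSpace ℝ E]
    {S : Set E} (hS : Dense S) {u u' : E} (h : ∀ y ∈ S, ⟪u, y⟫_ℝ = ⟪u', y⟫_ℝ) : u = u' := by
  refine ext_inner_right ℝ fun y => ?_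
  have hclosed : IsClosed {y : E | ⟪u, y⟫_ℝ = ⟪u', y⟫_ℝ} :=
    isClosed_eq (continuous_const.inner continuous_id) (continuous_const.inner continuous_id)
  have hy : y ∈ closure S := by rw [hS.closure_eq]; exact mem_univ y
  exact closure_minimal (fun y hy => h y hy) hclosed hy

/-- `|f| ≤ C ⇒ |∇̃f| ≤ 2C`. [folklore] -/
theorem abs_mgrad_le (i : Fin N) {f : Conf d N → ℝ} {C : ℝ} (hC : ∀ w, |f w| ≤ C)
    (p : Conf d N × Pt d) : |mgrad i f p| ≤ 2 * C := by
  rw [mgrad]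
  have h1 := hC p.1
  have h2 := hC (update p.1 i p.2)
  calc |f p.1 - f (update p.1 i p.2)| ≤ |f p.1| + |f (update p.1 i p.2)| := abs_sub _ _
    _ ≤ 2 * C := by linarith

namespace GasModel

variable (P : GasModel d) (N)

/-- Bounded measurable functions are in `L²(ν)` (indeed in every `Lᵖ`). [folklore] -/
theorem memLp_of_bdd {f : Conf d N → ℝ} (hfm : Measurable f) {C : ℝ} (hC : ∀ w, |f w| ≤ C) :
    MemLp f 2 (P.ν N) :=
  MemLp.of_bound hfm.aestronglyMeasurable C
    (Eventually.of_forall fun w => by rw [Real.norm_eq_abs]; exact hC w)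

/-- The one-particle integral `G_i f (w) = ∫_Λ e^{-βΣ_{j≠i}φ(w_j-z)} (f(w) - f(w^{i→z})) dz`. [folklore] -/
def sliceGen (i : Fin N) (f : Conf d N → ℝ) (w : Conf d N) : ℝ :=
  ∫ z, P.rate N i z w * mgrad i f (w, z) ∂P.μ₀

/-- **The negative generator** `A f = -𝓛 f = Σ_i |Λ|⁻¹ G_i f`, i.e.
`(𝓛 f)(η) = Σ_{x∈η} ∫_Λ dz/|Λ| e^{-β(H^{xz}-H^{x-})} (f(η^{xz}) - f(η))` (BCDP 2006 §5).
[cite: BoudouCaputoDaiPraPosta2006, §5] -/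
def negGen (f : Conf d N → ℝ) (w : Conf d N) : ℝ := ∑ i, P.vol⁻¹ * P.sliceGen N i f w

/-- The integrand `(w, z) ↦ rate_i(z, w) (f(w) - f(w^{i→z}))` is measurable. [folklore] -/
theorem measurable_rate_mul_mgrad (i : Fin N) {f : Conf d N → ℝ} (hfm : Measurable f) :
    Measurable fun p : Conf d N × Pt d => P.rate N i p.2 p.1 * mgrad i f p :=
  (P.measurable_rate N i).mul ((hfm.comp measurable_fst).sub (hfm.comp measurable_update'))

/-- `|rate_i · ∇̃f| ≤ 2C`. [folklore] -/
theorem abs_rate_mul_mgrad_le (i : Fin N) {f : Conf d N → ℝ} {C : ℝ} (hC : ∀ w, |f w| ≤ C)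
    (p : Conf d N × Pt d) : |P.rate N i p.2 p.1 * mgrad i f p| ≤ 2 * C := by
  rw [abs_mul, abs_of_pos (P.rate_pos N i _ _)]
  have hC0 : 0 ≤ C := (abs_nonneg _).trans (hC p.1)
  calc P.rate N i p.2 p.1 * |mgrad i f p| ≤ 1 * (2 * C) :=
        mul_le_mul (P.rate_le_one N i _ _) (abs_mgrad_le i hC p) (abs_nonneg _) zero_le_one
    _ = 2 * C := one_mul _

/-- `G_i f` is measurable. [folklore] -/
theorem measurable_sliceGen (i : Fin N) {f : Conf d N → ℝ} (hfm : Measurable f) :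
    Measurable (P.sliceGen N i f) :=
  ((P.measurable_rate_mul_mgrad N i hfm).stronglyMeasurable.integral_prod_right'
    (ν := P.μ₀)).measurable

/-- `|G_i f| ≤ 2C |Λ|`. [folklore] -/
theorem abs_sliceGen_le (i : Fin N) {f : Conf d N → ℝ} {C : ℝ} (hC : ∀ w, |f w| ≤ C)
    (w : Conf d N) : |P.sliceGen N i f w| ≤ 2 * C * P.vol := by
  rw [sliceGen, ← Real.norm_eq_abs, ← μ₀_real_univ]
  exact norm_integral_le_of_norm_le_const (Eventually.of_forall fun z => by
    rw [Real.norm_eq_abs]; exact P.abs_rate_mul_mgrad_le N i hC (w, z))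

/-- `A f` is measurable. [folklore] -/
theorem measurable_negGen {f : Conf d N → ℝ} (hfm : Measurable f) : Measurable (P.negGen N f) :=
  Finset.measurable_sum _ fun i _ => (P.measurable_sliceGen N i hfm).const_mul _

/-- `|A f| ≤ 2 N C` for `|f| ≤ C`. [folklore] -/
theorem abs_negGen_le {f : Conf d N → ℝ} {C : ℝ} (hC : ∀ w, |f w| ≤ C) (w : Conf d N) :
    |P.negGen N f w| ≤ 2 * N * C := by
  rw [negGen]
  calc |∑ i, P.vol⁻¹ * P.sliceGen N i f w| ≤ ∑ i, |P.vol⁻¹ * P.sliceGen N i f w| :=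
        Finset.abs_sum_le_sum_abs _ _
    _ ≤ ∑ _i : Fin N, 2 * C := by
        refine Finset.sum_le_sum fun i _ => ?_
        rw [abs_mul, abs_of_pos (inv_pos.2 P.vol_pos)]
        calc P.vol⁻¹ * |P.sliceGen N i f w| ≤ P.vol⁻¹ * (2 * C * P.vol) :=
              mul_le_mul_of_nonneg_left (P.abs_sliceGen_le N i hC w) (inv_pos.2 P.vol_pos).le
          _ = 2 * C := by field_simp [P.vol_pos.ne']
    _ = 2 * N * C := by
        rw [Finset.sum_const, Finset.card_univ, Fintype.card_fin, nsmul_eq_mul]; ring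

/-- **Integration by parts** for the `i`-th term: for bounded measurable `f, g`,
`ℰ_i(f, g) = 2 ∫ ∇̃_i f · (g ∘ fst) dR_i` (reversibility: the exchange map flips `∇̃_i f` and
swaps `g(w)` with `g(w^{i→z})`). [cite: BoudouCaputoDaiPraPosta2006, §2 (2.4)] -/
theorem formᵢ_eq_two_mul (i : Fin N) {f g : Conf d N → ℝ} (hfm : Measurable f) {Cf : ℝ}
    (hCf : ∀ w, |f w| ≤ Cf) (hgm : Measurable g) {Cg : ℝ} (hCg : ∀ w, |g w| ≤ Cg) :
    P.formᵢ N i f g = 2 * ∫ p, mgrad i f p * g p.1 ∂P.R N i := by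
  have hmf : Measurable (mgrad i f) := (hfm.comp measurable_fst).sub (hfm.comp measurable_update')
  have hint1 : Integrable (fun p => mgrad i f p * g p.1) (P.R N i) :=
    integrable_of_bdd (hmf.mul (hgm.comp measurable_fst)) (2 * Cf * Cg) fun p => by
      rw [abs_mul]
      exact mul_le_mul (abs_mgrad_le i hCf p) (hCg _) (abs_nonneg _)
        (by linarith [abs_nonneg (mgrad i f p), abs_mgrad_le i hCf p])
  have hint2 : Integrable (fun p => mgrad i f p * g (update p.1 i p.2)) (P.R N i) :=
    integrable_of_bdd (hmf.mul (hgm.comp measurable_update')) (2 * Cf * Cg) fun p => by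
      rw [abs_mul]
      exact mul_le_mul (abs_mgrad_le i hCf p) (hCg _) (abs_nonneg _)
        (by linarith [abs_nonneg (mgrad i f p), abs_mgrad_le i hCf p])
  have hswap : ∫ p, mgrad i f p * g (update p.1 i p.2) ∂P.R N i = -∫ p, mgrad i f p * g p.1 ∂P.R N i := by
    rw [← P.integral_comp_swapUpd N i (fun p => mgrad i f p * g (update p.1 i p.2)), ← integral_neg]
    refine integral_congr_ae (Eventually.of_forall fun p => ?_)
    simp only [mgrad_swapUpd, swapUpd_fst, swapUpd_snd, update_idem, update_eq_self]
    ring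
  have hsplit : (fun p => mgrad i f p * mgrad i g p) =
      fun p => mgrad i f p * g p.1 - mgrad i f p * g (update p.1 i p.2) := by
    funext p; simp only [mgrad]; ring
  rw [formᵢ, hsplit, integral_sub hint1 hint2, hswap]
  ring

/-- **The Dirichlet form is the form of the generator**: for bounded measurable `f, g`,
`ℰ(f, g) = ∫ (A f) g dν = -ν[g 𝓛 f]` (BCDP 2006 §2 (2.4): `𝓔(f,g) = -ν(f 𝓛 g)`).
[cite: BoudouCaputoDaiPraPosta2006, §2 (2.4)] -/
theorem form_eq_integral_negGen_mul {f g : Conf d N → ℝ} (hfm : Measurable f) {Cf : ℝ}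
    (hCf : ∀ w, |f w| ≤ Cf) (hgm : Measurable g) {Cg : ℝ} (hCg : ∀ w, |g w| ≤ Cg) :
    P.form N f g = ∫ w, P.negGen N f w * g w ∂P.ν N := by
  -- each term
  have hterm : ∀ i : Fin N, ∫ p, mgrad i f p * g p.1 ∂P.R N i =
      ∫ w, g w * P.sliceGen N i f w ∂P.ν N := by
    intro i
    rw [P.integral_R N i]
    have hint : Integrable (fun p : Conf d N × Pt d => P.rate N i p.2 p.1 • (mgrad i f p * g p.1))
        ((P.ν N).prod P.μ₀) := by
      refine integrable_of_bdd (((P.measurable_rate N i).smul (((hfm.comp measurable_fst).sub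
        (hfm.comp measurable_update')).mul (hgm.comp measurable_fst)))) (2 * Cf * Cg) fun p => ?_
      rw [smul_eq_mul, ← mul_assoc, abs_mul]
      exact mul_le_mul (P.abs_rate_mul_mgrad_le N i hCf p) (hCg _) (abs_nonneg _)
        (by linarith [abs_nonneg (P.rate N i p.2 p.1 * mgrad i f p), P.abs_rate_mul_mgrad_le N i hCf p])
    rw [integral_prod _ hint]
    refine integral_congr_ae (Eventually.of_forall fun w => ?_)
    simp only [sliceGen]
    rw [← integral_const_mul]
    refine integral_congr_ae (Eventually.of_forall fun z => ?_)
    simp only [smul_eq_mul]; ring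
  -- integrability of the terms in `w`
  have hint' : ∀ i : Fin N, Integrable (fun w => g w * P.sliceGen N i f w) (P.ν N) := by
    intro i
    refine integrable_of_bdd (hgm.mul (P.measurable_sliceGen N i hfm)) (Cg * (2 * Cf * P.vol))
      fun w => ?_
    rw [abs_mul]
    exact mul_le_mul (hCg w) (P.abs_sliceGen_le N i hCf w) (abs_nonneg _)
      ((abs_nonneg _).trans (hCg w))
  simp only [form, P.formᵢ_eq_two_mul N _ hfm hCf hgm hCg, hterm]
  have : ∀ i : Fin N, P.vol⁻¹ / 2 * (2 * ∫ w, g w * P.sliceGen N i f w ∂P.ν N) =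
      ∫ w, P.vol⁻¹ * (g w * P.sliceGen N i f w) ∂P.ν N := by
    intro i; rw [integral_const_mul]; ring
  simp only [this]
  rw [← integral_finsetSum _ fun i _ => (hint' i).const_mul _]
  refine integral_congr_ae (Eventually.of_forall fun w => ?_)
  simp only [negGen, Finset.sum_mul]
  refine Finset.sum_congr rfl fun i _ => ?_
  ring

/-- The dense set of (classes of) bounded measurable functions in `L²(ν)`. [folklore] -/
def bddClasses : Set (Lp ℝ 2 (P.ν N)) :=
  {x | ∃ g : Conf d N → ℝ, Measurable g ∧ (∃ C, ∀ w, |g w| ≤ C) ∧ (x : Conf d N → ℝ) =ᵐ[P.ν N] g}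

/-- Bounded measurable functions are dense in `L²(ν)` (simple functions already are). [folklore] -/
theorem dense_bddClasses : Dense (P.bddClasses N) := by
  refine (Lp.simpleFunc.dense (E := ℝ) (p := 2) (μ := P.ν N) ENNReal.ofNat_ne_top).mono ?_
  intro x hx
  set x' : Lp.simpleFunc ℝ 2 (P.ν N) := ⟨x, hx⟩
  obtain ⟨C, hC⟩ := (Lp.simpleFunc.toSimpleFunc x').exists_forall_norm_le
  refine ⟨Lp.simpleFunc.toSimpleFunc x', Lp.simpleFunc.measurable x', ⟨C, fun w => ?_⟩, ?_⟩
  · rw [← Real.norm_eq_abs]; exact hC w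
  · exact (Lp.simpleFunc.toSimpleFunc_eq_toFun x').symm

/-- The class of a bounded measurable function lies in `bddClasses`. [folklore] -/
theorem toLp_mem_bddClasses {f : Conf d N → ℝ} (hfm : Measurable f) {C : ℝ} (hC : ∀ w, |f w| ≤ C) :
    (P.memLp_of_bdd N hfm hC).toLp f ∈ P.bddClasses N :=
  ⟨f, hfm, ⟨C, hC⟩, MemLp.coeFn_toLp _⟩

/-- `⟪[u], [g]⟫ = ∫ u g dν` for bounded measurable `u`, `g`. [folklore] -/
theorem inner_toLp_toLp {u g : Conf d N → ℝ} (hum : Measurable u) {Cu : ℝ} (hCu : ∀ w, |u w| ≤ Cu)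
    (hgm : Measurable g) {Cg : ℝ} (hCg : ∀ w, |g w| ≤ Cg) :
    ⟪(P.memLp_of_bdd N hum hCu).toLp u, (P.memLp_of_bdd N hgm hCg).toLp g⟫_ℝ =
      ∫ w, u w * g w ∂P.ν N := by
  rw [L2.inner_def]
  refine integral_congr_ae ?_
  filter_upwards [(P.memLp_of_bdd N hum hCu).coeFn_toLp, (P.memLp_of_bdd N hgm hCg).coeFn_toLp]
    with w hu hg
  rw [hu, hg, real_inner_eq_re_inner, RCLike.inner_apply, conj_trivial, RCLike.re_to_real, mul_comm]

/-- **`A [f] = [A f]`**: on the class of a bounded measurable function the abstract generator is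
the class of the explicit one. [folklore] -/
theorem genOp_toLp {f : Conf d N → ℝ} (hfm : Measurable f) {C : ℝ} (hC : ∀ w, |f w| ≤ C) :
    P.genOp N ((P.memLp_of_bdd N hfm hC).toLp f) =
      (P.memLp_of_bdd N (P.measurable_negGen N hfm) (P.abs_negGen_le N hC)).toLp (P.negGen N f) := by
  refine eq_of_inner_eq_on_dense (P.dense_bddClasses N) fun y hy => ?_
  obtain ⟨g, hgm, ⟨Cg, hCg⟩, hyg⟩ := hy
  have hy : y = (P.memLp_of_bdd N hgm hCg).toLp g := by
    rw [← Lp.toLp_coeFn y (Lp.memLp y)]; exact MemLp.toLp_congr _ _ hyg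
  rw [hy, inner_genOp, P.inner_toLp_toLp N (P.measurable_negGen N hfm) (P.abs_negGen_le N hC) hgm hCg,
    P.form_congr_ae N (MemLp.coeFn_toLp _) (MemLp.coeFn_toLp _),
    P.form_eq_integral_negGen_mul N hfm hC hgm hCg]

/-- `‖A [f]‖² = ∫ (A f)² dν` for bounded measurable `f`. [folklore] -/
theorem norm_genOp_toLp_sq {f : Conf d N → ℝ} (hfm : Measurable f) {C : ℝ} (hC : ∀ w, |f w| ≤ C) :
    ‖P.genOp N ((P.memLp_of_bdd N hfm hC).toLp f)‖ ^ 2 = ∫ w, P.negGen N f w ^ 2 ∂P.ν N := by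
  rw [P.genOp_toLp N hfm hC, ← real_inner_self_eq_norm_sq,
    P.inner_toLp_toLp N (P.measurable_negGen N hfm) (P.abs_negGen_le N hC)
      (P.measurable_negGen N hfm) (P.abs_negGen_le N hC)]
  simp only [sq]

/-- `⟪A [f], [f]⟫ = ℰ(f, f)` for bounded measurable `f`. [folklore] -/
theorem inner_genOp_toLp_self {f : Conf d N → ℝ} (hfm : Measurable f) {C : ℝ} (hC : ∀ w, |f w| ≤ C) :
    ⟪P.genOp N ((P.memLp_of_bdd N hfm hC).toLp f), (P.memLp_of_bdd N hfm hC).toLp f⟫_ℝ =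
      P.form N f f := by
  rw [inner_genOp, P.form_congr_ae N (MemLp.coeFn_toLp _) (MemLp.coeFn_toLp _)]

end GasModel

end Generator

/-! ### Ergodicity: the kernel of the generator consists of constants -/

section Ergodic

variable {d N : ℕ}

namespace GasModel

variable (P : GasModel d) (N)

/-- Averaging over the position of particle `i`: `(E_i h)(w) = |Λ|⁻¹ ∫_Λ h(w^{i→z}) dz`. [folklore] -/
def avg (i : Fin N) (h : Conf d N → ℝ) (w : Conf d N) : ℝ := P.vol⁻¹ * ∫ z, h (update w i z) ∂P.μ₀

/-- The exchange map preserves `dw ⊗ dz`. [folklore] -/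
theorem measurePreserving_swapUpd_refProd (i : Fin N) :
    MeasurePreserving (swapUpd i) ((P.ref N).prod P.μ₀) ((P.ref N).prod P.μ₀) :=
  measurePreserving_swapUpd P.μ₀ i

/-- `(w, z) ↦ w^{i→z}` is quasi-measure-preserving `dw ⊗ dz → dw`. [folklore] -/
theorem quasiMeasurePreserving_upd_ref (i : Fin N) :
    Measure.QuasiMeasurePreserving (fun p : Conf d N × Pt d => update p.1 i p.2)
      ((P.ref N).prod P.μ₀) (P.ref N) :=
  Measure.quasiMeasurePreserving_fst.comp (P.measurePreserving_swapUpd_refProd N i).quasiMeasurePreserving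

/-- `E_i` respects `dw`-a.e. equality. [folklore] -/
theorem avg_congr_ae (i : Fin N) {h h' : Conf d N → ℝ} (hh : h =ᵐ[P.ref N] h') :
    P.avg N i h =ᵐ[P.ref N] P.avg N i h' := by
  have h1 := Measure.ae_ae_of_ae_prod ((P.quasiMeasurePreserving_upd_ref N i).ae_eq_comp hh)
  filter_upwards [h1] with w hw
  have hw' : ∀ᵐ z ∂P.μ₀, h (update w i z) = h' (update w i z) := hw
  simp only [avg]
  rw [integral_congr_ae hw']

/-- If `h(w) = h(w^{i→z})` for a.e. `(w, z)` then `h = E_i h` a.e. [folklore] -/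
theorem ae_eq_avg (i : Fin N) {h : Conf d N → ℝ}
    (hinv : ∀ᵐ p ∂(P.ref N).prod P.μ₀, h p.1 = h (update p.1 i p.2)) :
    h =ᵐ[P.ref N] P.avg N i h := by
  filter_upwards [Measure.ae_ae_of_ae_prod hinv] with w hw
  have hw' : ∀ᵐ z ∂P.μ₀, h w = h (update w i z) := hw
  simp only [avg]
  rw [← integral_congr_ae hw', integral_const, μ₀_real_univ, smul_eq_mul, ← mul_assoc,
    inv_mul_cancel₀ P.vol_pos.ne', one_mul]

/-- Iterated averaging over the positions of particles `0, …, m-1`. [folklore] -/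
def iterAvg (h : Conf d N → ℝ) : ℕ → Conf d N → ℝ
  | 0 => h
  | m + 1 => if hm : m < N then P.avg N ⟨m, hm⟩ (iterAvg h m) else iterAvg h m

/-- After averaging over particles `0, …, m-1` the function no longer depends on them. [folklore] -/
theorem iterAvg_eq_of_eqOn (h : Conf d N → ℝ) (m : ℕ) (w w' : Conf d N)
    (hww' : ∀ j : Fin N, m ≤ j.val → w j = w' j) : P.iterAvg N h m w = P.iterAvg N h m w' := by
  induction m generalizing w w' with
  | zero => exact congr_arg h (funext fun j => hww' j (Nat.zero_le _))
  | succ m ih =>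
    simp only [iterAvg]
    split_ifs with hm
    · simp only [avg]
      congr 1
      refine integral_congr_ae (Eventually.of_forall fun z => ih _ _ fun j hj => ?_)
      by_cases hji : j = ⟨m, hm⟩
      · subst hji; simp only [update_self]
      · have hjm : j.val ≠ m := fun h => hji (Fin.ext h)
        rw [update_of_ne hji, update_of_ne hji]
        exact hww' j (by omega)
    · exact ih _ _ fun j _ => hww' j (by omega)

/-- Under the invariance hypotheses, `h` agrees a.e. with all its iterated averages. [folklore] -/
theorem ae_eq_iterAvg {h : Conf d N → ℝ}
    (hinv : ∀ i : Fin N, ∀ᵐ p ∂(P.ref N).prod P.μ₀, h p.1 = h (update p.1 i p.2)) (m : ℕ) :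
    h =ᵐ[P.ref N] P.iterAvg N h m := by
  induction m with
  | zero => exact EventuallyEq.rfl
  | succ m ih =>
    simp only [iterAvg]
    split_ifs with hm
    · exact (P.ae_eq_avg N ⟨m, hm⟩ (hinv _)).trans (P.avg_congr_ae N _ ih)
    · exact ih

/-- **Ergodicity of the move-one-particle dynamics**: a function on `Λ^N` which is a.e. invariant
under every single-particle resampling is a.e. constant. [folklore] -/
theorem ae_eq_const_of_forall_invariant {h : Conf d N → ℝ}
    (hinv : ∀ i : Fin N, ∀ᵐ p ∂(P.ref N).prod P.μ₀, h p.1 = h (update p.1 i p.2)) :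
    ∃ c : ℝ, h =ᵐ[P.ref N] fun _ => c := by
  refine ⟨P.iterAvg N h N (fun _ => 0), ?_⟩
  filter_upwards [P.ae_eq_iterAvg N hinv N] with w hw
  rw [hw]
  exact P.iterAvg_eq_of_eqOn N h N w _ fun j hj => absurd j.isLt (not_lt.2 hj)

/-- `dw ⊗ dz ≪ R_i`. [folklore] -/
theorem refProd_absolutelyContinuous_R (i : Fin N) : (P.ref N).prod P.μ₀ ≪ P.R N i :=
  (P.refProd_absolutelyContinuous_prod N).trans (P.prod_absolutelyContinuous_R N i)

/-- **`ker A = constants`**: an `L²(ν)` function with `ℰ(g, g) = 0` is `ν`-a.e. constant (all rates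
are positive because `φ < ∞`; BCDP 2006 §1: "`gap(𝓛) > 0` … is equivalent to the fact that `0` is
a simple eigenvalue for `𝓛`"). [folklore] -/
theorem ae_eq_const_of_form_self_eq_zero {g : Conf d N → ℝ} (hg : MemLp g 2 (P.ν N))
    (h0 : P.form N g g = 0) : ∃ c : ℝ, g =ᵐ[P.ν N] fun _ => c := by
  have hcoef : ∀ i : Fin N, 0 < P.vol⁻¹ / 2 := fun _ => div_pos (inv_pos.2 P.vol_pos) two_pos
  have hterm : ∀ i : Fin N, P.formᵢ N i g g = 0 := by
    intro i
    have h := (Finset.sum_eq_zero_iff_of_nonneg fun j _ =>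
      mul_nonneg (hcoef j).le (P.formᵢ_self_nonneg N j g)).1 h0 i (Finset.mem_univ i)
    rcases mul_eq_zero.1 h with h | h
    · exact absurd h (hcoef i).ne'
    · exact h
  have hinv : ∀ i : Fin N, ∀ᵐ p ∂(P.ref N).prod P.μ₀, g p.1 = g (update p.1 i p.2) := by
    intro i
    have hint : Integrable (fun p => mgrad i g p * mgrad i g p) (P.R N i) :=
      P.integrable_mgrad_mul N i hg hg
    have hae : (fun p => mgrad i g p * mgrad i g p) =ᵐ[P.R N i] 0 :=
      (integral_eq_zero_iff_of_nonneg_ae (Eventually.of_forall fun p => mul_self_nonneg _) hint).1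
        (hterm i)
    have hae' : ∀ᵐ p ∂P.R N i, g p.1 = g (update p.1 i p.2) := by
      filter_upwards [hae] with p hp
      have := mul_self_eq_zero.1 hp
      rwa [mgrad, sub_eq_zero] at this
    exact (P.refProd_absolutelyContinuous_R N i).ae_le hae'
  obtain ⟨c, hc⟩ := P.ae_eq_const_of_forall_invariant N hinv
  exact ⟨c, (P.ν_absolutelyContinuous N).ae_le hc⟩

/-- **`ker A ⊥ (f - ν[f])`**: if `A y = 0` then `y` is a.e. constant, hence orthogonal to every
centred class. [folklore] -/
theorem inner_eq_zero_of_genOp_eq_zero {y : Lp ℝ 2 (P.ν N)} (hy : P.genOp N y = 0)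
    {u : Conf d N → ℝ} (hu : MemLp u 2 (P.ν N)) (hu0 : ∫ w, u w ∂P.ν N = 0) :
    ⟪y, hu.toLp u⟫_ℝ = 0 := by
  have h0 : P.form N y y = 0 := by rw [← inner_genOp, hy, inner_zero_left]
  obtain ⟨c, hc⟩ := P.ae_eq_const_of_form_self_eq_zero N (Lp.memLp y) h0
  rw [L2.inner_def]
  calc ∫ w, ⟪(y : Conf d N → ℝ) w, (hu.toLp u : Conf d N → ℝ) w⟫_ℝ ∂P.ν N = ∫ w, c * u w ∂P.ν N := by
        refine integral_congr_ae ?_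
        filter_upwards [hc, hu.coeFn_toLp] with w h1 h2
        rw [h1, h2, real_inner_eq_re_inner, RCLike.inner_apply, conj_trivial, RCLike.re_to_real,
          mul_comm]
    _ = 0 := by rw [integral_const_mul, hu0, mul_zero]

end GasModel

end Ergodic

/-! ### Two moving particles: the measures `T_{ij}`, `R_{ij}` and their symmetries -/

section Triple

variable {d N : ℕ}

/-- The swap of the two extra points: `((w, z), v) ↦ ((w, v), z)`. [folklore] -/
def swap₂ (q : (Conf d N × Pt d) × Pt d) : (Conf d N × Pt d) × Pt d := ((q.1.1, q.2), q.1.2)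

/-- Unfolding of `swap₂`. [folklore] -/
@[simp] theorem swap₂_apply (q : (Conf d N × Pt d) × Pt d) : swap₂ q = ((q.1.1, q.2), q.1.2) := rfl

/-- `swap₂` is an involution. [folklore] -/
@[simp] theorem swap₂_swap₂ (q : (Conf d N × Pt d) × Pt d) : swap₂ (swap₂ q) = q := rfl

/-- `swap₂` is measurable. [folklore] -/
@[fun_prop]
theorem measurable_swap₂ : Measurable (swap₂ : (Conf d N × Pt d) × Pt d → _) :=
  ((measurable_fst.comp measurable_fst).prodMk measurable_snd).prodMk (measurable_snd.comp measurable_fst)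

/-- `swap₂` as a measurable involution. [folklore] -/
def swap₂Equiv : (Conf d N × Pt d) × Pt d ≃ᵐ (Conf d N × Pt d) × Pt d where
  toFun := swap₂
  invFun := swap₂
  left_inv := swap₂_swap₂
  right_inv := swap₂_swap₂
  measurable_toFun := measurable_swap₂
  measurable_invFun := measurable_swap₂

/-- The `swap₂` equivalence is `swap₂`. [folklore] -/
@[simp] theorem coe_swap₂Equiv : ⇑(swap₂Equiv : (Conf d N × Pt d) × Pt d ≃ᵐ _) = swap₂ := rfl

/-- The exchange of particle `i` with the first extra point, the second being a spectator. [folklore] -/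
def swapUpdFst (i : Fin N) : (Conf d N × Pt d) × Pt d ≃ᵐ (Conf d N × Pt d) × Pt d :=
  MeasurableEquiv.prodCongr (swapUpdEquiv i) (MeasurableEquiv.refl (Pt d))

/-- Unfolding of `swapUpdFst`. [folklore] -/
@[simp] theorem swapUpdFst_apply (i : Fin N) (q : (Conf d N × Pt d) × Pt d) :
    swapUpdFst i q = (swapUpd i q.1, q.2) := rfl

namespace GasModel

variable (P : GasModel d) (N)

/-- The triple product `dw ⊗ dz ⊗ dv` on `Λ^N × Λ × Λ`. [folklore] -/
def π₃ : Measure ((Conf d N × Pt d) × Pt d) := ((P.ref N).prod P.μ₀).prod P.μ₀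

/-- The triple product is a finite measure. [folklore] -/
instance : IsFiniteMeasure (P.π₃ N) := by unfold π₃; infer_instance

/-- `swap₂` preserves the triple product. [folklore] -/
theorem measurePreserving_swap₂ : MeasurePreserving swap₂ (P.π₃ N) (P.π₃ N) := by
  have h1 := measurePreserving_prodAssoc (P.ref N) P.μ₀ P.μ₀
  have h2 : MeasurePreserving (Prod.map id Prod.swap) ((P.ref N).prod (P.μ₀.prod P.μ₀))
      ((P.ref N).prod (P.μ₀.prod P.μ₀)) :=
    (MeasurePreserving.id (P.ref N)).prod Measure.measurePreserving_swap
  have h := h1.symm.comp (h2.comp h1)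
  have hfun : (⇑(MeasurableEquiv.prodAssoc : ((Conf d N × Pt d) × Pt d) ≃ᵐ _).symm ∘ Prod.map id Prod.swap ∘
      ⇑(MeasurableEquiv.prodAssoc : ((Conf d N × Pt d) × Pt d) ≃ᵐ _)) = swap₂ := by
    funext q; rfl
  rw [hfun] at h
  exact h

/-- The first-slot exchange preserves the triple product. [folklore] -/
theorem measurePreserving_swapUpdFst (i : Fin N) :
    MeasurePreserving (swapUpdFst i) (P.π₃ N) (P.π₃ N) := by
  have h := (measurePreserving_swapUpd P.μ₀ i).prod (MeasurePreserving.id P.μ₀)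
  exact h

/-- The density of `T_{ij}`: `Z⁻¹ e^{-βW_i(w,z)} · e^{-βΣ_{l≠j}φ(w_l - v)}`. [folklore] -/
def T₂dens (i j : Fin N) (q : (Conf d N × Pt d) × Pt d) : ℝ := P.Rdens N i q.1 * P.rate N j q.2 q.1.1

/-- The Boltzmann factor of the pair of extra points, `e^{-βφ(z - v)}`. [folklore] -/
def epair (q : (Conf d N × Pt d) × Pt d) : ℝ := Real.exp (-(P.β * P.φ (q.1.2 - q.2)))

/-- The density of `R_{ij}`: `Z⁻¹ e^{-βW_i(w,z)} e^{-βΣ_{l≠j}φ(w_l - v)} e^{-βφ(z-v)}`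
(the measure `R` of BCDP 2006 Lemma 5.1 with `r(·, xz, yv) = e^{-βφ(z-v)}`).
[cite: BoudouCaputoDaiPraPosta2006, §5 Lemma 5.1] -/
def R₂dens (i j : Fin N) (q : (Conf d N × Pt d) × Pt d) : ℝ := P.T₂dens N i j q * P.epair N q

/-- `0 < epair`. [folklore] -/
theorem epair_pos (q : (Conf d N × Pt d) × Pt d) : 0 < P.epair N q := Real.exp_pos _

/-- `epair ≤ 1`. [folklore] -/
theorem epair_le_one (q : (Conf d N × Pt d) × Pt d) : P.epair N q ≤ 1 :=
  Real.exp_le_one_iff.2 (neg_nonpos.2 (mul_nonneg P.β_nonneg (P.φ_nonneg _)))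

/-- `epair` is symmetric in the two extra points (`φ` even). [folklore] -/
theorem epair_swap₂ (q : (Conf d N × Pt d) × Pt d) : P.epair N (swap₂ q) = P.epair N q := by
  simp only [epair, swap₂_apply]
  rw [← P.φ_even, neg_sub]

/-- `epair` is measurable. [folklore] -/
theorem measurable_epair : Measurable (P.epair N) := by
  have h : Measurable fun q : (Conf d N × Pt d) × Pt d => P.φ (q.1.2 - q.2) :=
    P.measurable_φ.comp ((measurable_snd.comp measurable_fst).sub measurable_snd)
  exact ((h.const_mul _).neg).exp

/-- `T₂dens` is measurable. [folklore] -/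
theorem measurable_T₂dens (i j : Fin N) : Measurable (P.T₂dens N i j) := by
  have h1 : Measurable fun q : (Conf d N × Pt d) × Pt d => P.Rdens N i q.1 :=
    (P.measurable_Rdens N i).comp measurable_fst
  have h2 : Measurable ((fun p : Conf d N × Pt d => P.rate N j p.2 p.1) ∘
      fun q : (Conf d N × Pt d) × Pt d => (q.1.1, q.2)) :=
    (P.measurable_rate N j).comp ((measurable_fst.comp measurable_fst).prodMk measurable_snd)
  exact h1.mul h2

/-- `R₂dens` is measurable. [folklore] -/
theorem measurable_R₂dens (i j : Fin N) : Measurable (P.R₂dens N i j) := by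
  have h := (P.measurable_T₂dens N i j).mul (P.measurable_epair N)
  exact h

/-- `0 < T₂dens`. [folklore] -/
theorem T₂dens_pos (i j : Fin N) (q : (Conf d N × Pt d) × Pt d) : 0 < P.T₂dens N i j q :=
  mul_pos (P.Rdens_pos N i _) (P.rate_pos N j _ _)

/-- `0 < R₂dens`. [folklore] -/
theorem R₂dens_pos (i j : Fin N) (q : (Conf d N × Pt d) × Pt d) : 0 < P.R₂dens N i j q :=
  mul_pos (P.T₂dens_pos N i j q) (P.epair_pos N q)

/-- The measure `T_{ij}(dw dz dv) = ν(dw) rate_i(z,w) dz rate_j(v,w) dv`. [folklore] -/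
def T₂ (i j : Fin N) : Measure ((Conf d N × Pt d) × Pt d) :=
  (P.π₃ N).withDensity fun q => ENNReal.ofReal (P.T₂dens N i j q)

/-- The measure `R_{ij} = e^{-βφ(z-v)} T_{ij}`. [cite: BoudouCaputoDaiPraPosta2006, §5 Lemma 5.1] -/
def R₂ (i j : Fin N) : Measure ((Conf d N × Pt d) × Pt d) :=
  (P.π₃ N).withDensity fun q => ENNReal.ofReal (P.R₂dens N i j q)

/-- `T_{ij}` is a finite measure. [folklore] -/
instance (i j : Fin N) : IsFiniteMeasure (P.T₂ N i j) := by
  refine ⟨?_⟩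
  rw [T₂, withDensity_apply _ MeasurableSet.univ, Measure.restrict_univ]
  have hb : ∀ q, ENNReal.ofReal (P.T₂dens N i j q) ≤ ENNReal.ofReal (P.Z N)⁻¹ := fun q => by
    refine ENNReal.ofReal_le_ofReal ?_
    rw [T₂dens, Rdens, mul_assoc]
    refine mul_le_of_le_one_right (inv_pos.2 (P.Z_pos N)).le ?_
    refine mul_le_one₀ (Real.exp_le_one_iff.2 (neg_nonpos.2 (mul_nonneg P.β_nonneg ?_)))
      (P.rate_pos N j _ _).le (P.rate_le_one N j _ _)
    exact add_nonneg (P.H_nonneg N _) (P.sum_ite_ne_φ_nonneg N i _ _)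
  calc ∫⁻ q, ENNReal.ofReal (P.T₂dens N i j q) ∂P.π₃ N ≤ ∫⁻ _, ENNReal.ofReal (P.Z N)⁻¹ ∂P.π₃ N :=
        lintegral_mono hb
    _ < ∞ := by rw [lintegral_const]; exact ENNReal.mul_lt_top ENNReal.ofReal_lt_top (measure_lt_top _ _)

/-- `R_{ij} ≤ T_{ij}`. [folklore] -/
theorem R₂_le_T₂ (i j : Fin N) : P.R₂ N i j ≤ P.T₂ N i j :=
  withDensity_mono (Eventually.of_forall fun q => ENNReal.ofReal_le_ofReal
    (mul_le_of_le_one_right (P.T₂dens_pos N i j q).le (P.epair_le_one N q)))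

/-- `R_{ij}` is a finite measure. [folklore] -/
instance (i j : Fin N) : IsFiniteMeasure (P.R₂ N i j) :=
  isFiniteMeasure_of_le _ (P.R₂_le_T₂ N i j)

/-- The interaction of the spectator point `v` with `(w_{-j}, z)` is invariant under `wᵢ ↔ z`
(`i ≠ j`). [folklore] -/
theorem sum_ite_ne_update_add (i j : Fin N) (hij : i ≠ j) (w : Conf d N) (z v : Pt d) :
    (∑ l, if l ≠ j then P.φ (update w i z l - v) else 0) + P.φ (w i - v) =
      (∑ l, if l ≠ j then P.φ (w l - v) else 0) + P.φ (z - v) := by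
  rw [sum_ite_ne, sum_ite_ne]
  have hi : i ∈ Finset.univ.erase j := Finset.mem_erase.2 ⟨hij, Finset.mem_univ i⟩
  rw [← Finset.add_sum_erase _ _ hi, ← Finset.add_sum_erase _ (fun l => P.φ (w l - v)) hi, update_self]
  have : ∑ l ∈ (Finset.univ.erase j).erase i, P.φ (update w i z l - v) =
      ∑ l ∈ (Finset.univ.erase j).erase i, P.φ (w l - v) :=
    Finset.sum_congr rfl fun l hl => by rw [update_of_ne (Finset.mem_erase.1 hl).1]
  rw [this]; ring

/-- **(A4) for two particles**: `R_{ij}`'s density is invariant under the first-slot exchange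
(`i ≠ j`). [cite: BoudouCaputoDaiPraPosta2006, §5 Lemma 5.1] -/
theorem R₂dens_swapUpdFst (i j : Fin N) (hij : i ≠ j) (q : (Conf d N × Pt d) × Pt d) :
    P.R₂dens N i j (swapUpdFst i q) = P.R₂dens N i j q := by
  obtain ⟨⟨w, z⟩, v⟩ := q
  simp only [R₂dens, T₂dens, epair, swapUpdFst_apply, Rdens_swapUpd, swapUpd_fst, swapUpd_snd, rate,
    mul_assoc]
  congr 1
  rw [← Real.exp_add, ← Real.exp_add]
  congr 1
  have h := P.sum_ite_ne_update_add N i j hij w z v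
  calc -(P.β * ∑ l, if l ≠ j then P.φ (update w i z l - v) else 0) + -(P.β * P.φ (w i - v))
      = -(P.β * ((∑ l, if l ≠ j then P.φ (update w i z l - v) else 0) + P.φ (w i - v))) := by ring
    _ = -(P.β * ((∑ l, if l ≠ j then P.φ (w l - v) else 0) + P.φ (z - v))) := by rw [h]
    _ = _ := by ring

/-- The first-slot exchange preserves `R_{ij}` (`i ≠ j`). [cite: BoudouCaputoDaiPraPosta2006, §5 Lemma 5.1] -/
theorem measurePreserving_swapUpdFst_R₂ (i j : Fin N) (hij : i ≠ j) :
    MeasurePreserving (swapUpdFst i) (P.R₂ N i j) (P.R₂ N i j) :=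
  (P.measurePreserving_swapUpdFst N i).withDensity_congr (swapUpdFst i) fun q => by
    simp only [R₂dens_swapUpdFst _ _ _ _ hij]

/-- A closed form of `T_{ij}`'s density. [folklore] -/
theorem T₂dens_eq (i j : Fin N) (q : (Conf d N × Pt d) × Pt d) :
    P.T₂dens N i j q = (P.Z N)⁻¹ * Real.exp (-(P.β * (P.H N q.1.1 +
      (∑ l, if l ≠ i then P.φ (q.1.1 l - q.1.2) else 0) +
      (∑ l, if l ≠ j then P.φ (q.1.1 l - q.2) else 0)))) := by
  simp only [T₂dens, Rdens, pairW, rate, mul_assoc, ← Real.exp_add]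
  congr 2
  ring

/-- `T_{ij}`'s density at the swapped extra points is `T_{ji}`'s density. [folklore] -/
theorem T₂dens_swap₂ (i j : Fin N) (q : (Conf d N × Pt d) × Pt d) :
    P.T₂dens N i j (swap₂ q) = P.T₂dens N j i q := by
  rw [T₂dens_eq, T₂dens_eq]
  simp only [swap₂_apply]
  congr 3
  ring

/-- `R_{ij}`'s density at the swapped extra points is `R_{ji}`'s density (**(A3)**, `φ` even).
[cite: BoudouCaputoDaiPraPosta2006, §5 Lemma 5.1] -/
theorem R₂dens_swap₂ (i j : Fin N) (q : (Conf d N × Pt d) × Pt d) :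
    P.R₂dens N i j (swap₂ q) = P.R₂dens N j i q := by
  rw [R₂dens, R₂dens, T₂dens_swap₂, epair_swap₂]

/-- `swap₂ : T_{ji} → T_{ij}` is measure preserving. [folklore] -/
theorem measurePreserving_swap₂_T₂ (i j : Fin N) :
    MeasurePreserving swap₂ (P.T₂ N j i) (P.T₂ N i j) :=
  (P.measurePreserving_swap₂ N).withDensity_congr swap₂Equiv fun q => by
    simp only [coe_swap₂Equiv, T₂dens_swap₂]

/-- `swap₂ : R_{ji} → R_{ij}` is measure preserving. [folklore] -/
theorem measurePreserving_swap₂_R₂ (i j : Fin N) :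
    MeasurePreserving swap₂ (P.R₂ N j i) (P.R₂ N i j) :=
  (P.measurePreserving_swap₂ N).withDensity_congr swap₂Equiv fun q => by
    simp only [coe_swap₂Equiv, R₂dens_swap₂]

/-- Change of variables `swap₂` in `T`-integrals. [folklore] -/
theorem integral_T₂_comp_swap₂ (i j : Fin N) (F : (Conf d N × Pt d) × Pt d → ℝ) :
    ∫ q, F (swap₂ q) ∂P.T₂ N j i = ∫ q, F q ∂P.T₂ N i j :=
  (P.measurePreserving_swap₂_T₂ N i j).integral_comp swap₂Equiv.measurableEmbedding F

/-- Change of variables `swap₂` in `R`-integrals. [folklore] -/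
theorem integral_R₂_comp_swap₂ (i j : Fin N) (F : (Conf d N × Pt d) × Pt d → ℝ) :
    ∫ q, F (swap₂ q) ∂P.R₂ N j i = ∫ q, F q ∂P.R₂ N i j :=
  (P.measurePreserving_swap₂_R₂ N i j).integral_comp swap₂Equiv.measurableEmbedding F

/-- Change of variables by the first-slot exchange in `R_{ij}`-integrals. [folklore] -/
theorem integral_R₂_comp_swapUpdFst (i j : Fin N) (hij : i ≠ j) (F : (Conf d N × Pt d) × Pt d → ℝ) :
    ∫ q, F (swapUpdFst i q) ∂P.R₂ N i j = ∫ q, F q ∂P.R₂ N i j :=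
  (P.measurePreserving_swapUpdFst_R₂ N i j hij).integral_comp (swapUpdFst i).measurableEmbedding F

/-- `T_{ij} = (R_i ⊗ dv) · rate_j(v, w)`. [folklore] -/
theorem T₂_eq (i j : Fin N) : P.T₂ N i j =
    ((P.R N i).prod P.μ₀).withDensity fun q => ENNReal.ofReal (P.rate N j q.2 q.1.1) := by
  have h1 : Measurable fun q : (Conf d N × Pt d) × Pt d => ENNReal.ofReal (P.Rdens N i q.1) :=
    (P.measurable_Rdens N i).ennreal_ofReal.comp measurable_fst
  have h2 : Measurable fun q : (Conf d N × Pt d) × Pt d => ENNReal.ofReal (P.rate N j q.2 q.1.1) :=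
    ((P.measurable_rate N j).comp ((measurable_fst.comp measurable_fst).prodMk measurable_snd)).ennreal_ofReal
  rw [R_eq_withDensity, prod_withDensity_left (P.measurable_Rdens N i).ennreal_ofReal,
    ← withDensity_mul _ h1 h2, T₂, π₃]
  congr 1
  funext q
  simp only [Pi.mul_apply, T₂dens]
  rw [ENNReal.ofReal_mul (P.Rdens_pos N i _).le]

/-- `R_{ij} = e^{-βφ(z-v)} T_{ij}`. [folklore] -/
theorem R₂_eq (i j : Fin N) :
    P.R₂ N i j = (P.T₂ N i j).withDensity fun q => ENNReal.ofReal (P.epair N q) := by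
  rw [T₂, ← withDensity_mul _ (P.measurable_T₂dens N i j).ennreal_ofReal
    (P.measurable_epair N).ennreal_ofReal, R₂]
  congr 1
  funext q
  simp only [Pi.mul_apply, R₂dens]
  rw [ENNReal.ofReal_mul (P.T₂dens_pos N i j q).le]

/-- `∫ F dT_{ij} = ∫_{R_i} ∫ rate_j(v, w) F((w,z),v) dv`, for integrable `F`. [folklore] -/
theorem integral_T₂ (i j : Fin N) {F : (Conf d N × Pt d) × Pt d → ℝ}
    (hF : Integrable (fun q => P.rate N j q.2 q.1.1 * F q) ((P.R N i).prod P.μ₀)) :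
    ∫ q, F q ∂P.T₂ N i j = ∫ p, ∫ v, P.rate N j v p.1 * F (p, v) ∂P.μ₀ ∂P.R N i := by
  have h2 : Measurable fun q : (Conf d N × Pt d) × Pt d => ENNReal.ofReal (P.rate N j q.2 q.1.1) :=
    ((P.measurable_rate N j).comp ((measurable_fst.comp measurable_fst).prodMk measurable_snd)).ennreal_ofReal
  rw [T₂_eq, integral_withDensity_eq_integral_toReal_smul h2
    (Eventually.of_forall fun _ => ENNReal.ofReal_lt_top)]
  have : (fun q : (Conf d N × Pt d) × Pt d => (ENNReal.ofReal (P.rate N j q.2 q.1.1)).toReal • F q) =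
      fun q => P.rate N j q.2 q.1.1 * F q := by
    funext q; rw [ENNReal.toReal_ofReal (P.rate_pos N j _ _).le, smul_eq_mul]
  rw [this, integral_prod _ hF]

/-- `∫ F dR_{ij} = ∫ e^{-βφ(z-v)} F dT_{ij}`. [folklore] -/
theorem integral_R₂ (i j : Fin N) (F : (Conf d N × Pt d) × Pt d → ℝ) :
    ∫ q, F q ∂P.R₂ N i j = ∫ q, P.epair N q * F q ∂P.T₂ N i j := by
  rw [R₂_eq, integral_withDensity_eq_integral_toReal_smul (P.measurable_epair N).ennreal_ofReal
    (Eventually.of_forall fun _ => ENNReal.ofReal_lt_top)]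
  refine integral_congr_ae (Eventually.of_forall fun q => ?_)
  dsimp only
  rw [ENNReal.toReal_ofReal (P.epair_pos N q).le, smul_eq_mul]

end GasModel

end Triple

/-! ### The small-density estimates (`ε₁, ε₂ ≤ (N-1) ε(β)/|Λ|`, BCDP 2006 Cor. 5.2) -/

section EpsBounds

variable {d N : ℕ}

/-- `1 - e^{-Σ tⱼ} ≤ Σ (1 - e^{-tⱼ})` for `tⱼ ≥ 0` (BCDP 2006, proof of Cor. 5.2:
"the elementary inequality `1 - e^{-s-t} ≤ (1 - e^{-s}) + (1 - e^{-t})`, `s, t ≥ 0`").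
[cite: BoudouCaputoDaiPraPosta2006, §5 Cor. 5.2] -/
theorem one_sub_exp_neg_sum_le (s : Finset (Fin N)) (t : Fin N → ℝ) (ht : ∀ j, 0 ≤ t j) :
    1 - Real.exp (-(∑ j ∈ s, t j)) ≤ ∑ j ∈ s, (1 - Real.exp (-(t j))) := by
  induction s using Finset.induction_on with
  | empty => simp
  | @insert a s ha ih =>
    rw [Finset.sum_insert ha, Finset.sum_insert ha, neg_add, Real.exp_add]
    have h1 : Real.exp (-(t a)) ≤ 1 := Real.exp_le_one_iff.2 (neg_nonpos.2 (ht a))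
    have h2 : Real.exp (-(∑ j ∈ s, t j)) ≤ 1 :=
      Real.exp_le_one_iff.2 (neg_nonpos.2 (Finset.sum_nonneg fun j _ => ht j))
    have h3 : 0 ≤ Real.exp (-(t a)) := (Real.exp_pos _).le
    nlinarith [mul_nonneg (sub_nonneg.2 h1) (sub_nonneg.2 h2)]

namespace GasModel

variable (P : GasModel d) (N)

/-- **One displaced copy of the Mayer integral**: `∫_Λ (1 - e^{-βφ(x - v)}) dv ≤ ε(β)` (monotonicity
in the domain, evenness of `φ`, translation invariance of Lebesgue measure). [cite: BoudouCaputoDaiPraPosta2006, §5 Cor. 5.2] -/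
theorem integral_oneSubExp_sub_le (x : Pt d) :
    ∫ v, (1 - Real.exp (-(P.β * P.φ (x - v)))) ∂P.μ₀ ≤ P.ε := by
  set g : Pt d → ℝ := fun u => 1 - Real.exp (-(P.β * P.φ u)) with hg_def
  have hg : ∀ v, 1 - Real.exp (-(P.β * P.φ (x - v))) = g (v - x) := by
    intro v
    simp only [hg_def]
    rw [← neg_sub v x, P.φ_even]
  have hgi : Integrable (fun v => g (v - x)) (volume : Measure (Pt d)) :=
    P.integrable_oneSubExp.comp_sub_right x
  calc ∫ v, (1 - Real.exp (-(P.β * P.φ (x - v)))) ∂P.μ₀ = ∫ v, g (v - x) ∂P.μ₀ :=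
        integral_congr_ae (Eventually.of_forall hg)
    _ ≤ ∫ v, g (v - x) ∂(volume : Measure (Pt d)) :=
        integral_mono_measure P.μ₀_le_volume (Eventually.of_forall fun v => P.oneSubExp_nonneg (v - x)) hgi
    _ = ∫ u, g u ∂(volume : Measure (Pt d)) := integral_sub_right_eq_self g x
    _ = P.ε := rfl

/-- The rate of moving particle `i` as a function of the target point is measurable. [folklore] -/
theorem measurable_rate_left (i : Fin N) (w : Conf d N) : Measurable fun v => P.rate N i v w := by
  have h := (P.measurable_rate N i).comp (measurable_prodMk_left (x := w))
  exact h

/-- The total jump rate ("mass") of particle `i`: `m_i(w) = ∫_Λ e^{-βΣ_{j≠i}φ(w_j - v)} dv`. [folklore] -/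
def mass (i : Fin N) (w : Conf d N) : ℝ := ∫ v, P.rate N i v w ∂P.μ₀

/-- `m_i` does not depend on the position of particle `i`. [folklore] -/
theorem mass_update (i : Fin N) (w : Conf d N) (z : Pt d) : P.mass N i (update w i z) = P.mass N i w := by
  simp only [mass, rate_update]

/-- **`ε₁`-bound** (BCDP 2006 (5.6) and Cor. 5.2): `m_i(w) ≥ |Λ| - (N-1) ε(β)`, i.e.
`∫_Λ dv/|Λ| (1 - e^{-βΣ_{x∈η}φ(v-x)}) ≤ (N-1)ε(β)/|Λ|`. [cite: BoudouCaputoDaiPraPosta2006, §5 Cor. 5.2] -/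
theorem vol_sub_le_mass (i : Fin N) (w : Conf d N) :
    P.vol - ((N - 1 : ℕ) : ℝ) * P.ε ≤ P.mass N i w := by
  have hrate_int : Integrable (fun v => P.rate N i v w) P.μ₀ :=
    integrable_of_bdd (P.measurable_rate_left N i w) 1 fun v => by
      rw [abs_of_pos (P.rate_pos N i v w)]; exact P.rate_le_one N i v w
  have hmass : P.mass N i w = P.vol - ∫ v, (1 - P.rate N i v w) ∂P.μ₀ := by
    rw [mass, integral_sub (integrable_const _) hrate_int, integral_const, μ₀_real_univ, smul_eq_mul,
      mul_one]
    ring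
  rw [hmass, sub_le_sub_iff_left]
  -- pointwise: `1 - rate ≤ Σ_{j ≠ i} (1 - e^{-βφ(w_j - v)})`
  have hpt : ∀ v, 1 - P.rate N i v w ≤ ∑ j ∈ Finset.univ.erase i, (1 - Real.exp (-(P.β * P.φ (w j - v)))) := by
    intro v
    have h := one_sub_exp_neg_sum_le (Finset.univ.erase i) (fun j => P.β * P.φ (w j - v))
      fun j => mul_nonneg P.β_nonneg (P.φ_nonneg _)
    have hr : P.rate N i v w = Real.exp (-(∑ j ∈ Finset.univ.erase i, P.β * P.φ (w j - v))) := by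
      rw [rate, sum_ite_ne, Finset.mul_sum]
    rw [hr]; exact h
  have hint : ∀ j : Fin N, Integrable (fun v => 1 - Real.exp (-(P.β * P.φ (w j - v)))) P.μ₀ := by
    intro j
    refine integrable_of_bdd (measurable_const.sub (((P.measurable_φ.comp
      (measurable_const.sub measurable_id)).const_mul _).neg.exp)) 1 fun v => ?_
    rw [abs_of_nonneg (P.oneSubExp_nonneg _)]
    linarith [Real.exp_pos (-(P.β * P.φ (w j - v)))]
  calc ∫ v, (1 - P.rate N i v w) ∂P.μ₀
      ≤ ∫ v, ∑ j ∈ Finset.univ.erase i, (1 - Real.exp (-(P.β * P.φ (w j - v)))) ∂P.μ₀ :=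
        integral_mono ((integrable_const _).sub hrate_int) (integrable_finsetSum _ fun j _ => hint j) hpt
    _ = ∑ j ∈ Finset.univ.erase i, ∫ v, (1 - Real.exp (-(P.β * P.φ (w j - v)))) ∂P.μ₀ :=
        integral_finsetSum _ fun j _ => hint j
    _ ≤ ∑ _j ∈ Finset.univ.erase i, P.ε := Finset.sum_le_sum fun j _ => P.integral_oneSubExp_sub_le (w j)
    _ = ((N - 1 : ℕ) : ℝ) * P.ε := by
        rw [Finset.sum_const, Finset.card_erase_of_mem (Finset.mem_univ i), Finset.card_univ,
          Fintype.card_fin, nsmul_eq_mul]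

/-- `0 ≤ m_i ≤ |Λ|`. [folklore] -/
theorem mass_le_vol (i : Fin N) (w : Conf d N) : P.mass N i w ≤ P.vol := by
  rw [mass, ← mul_one P.vol, ← μ₀_real_univ, ← smul_eq_mul, ← integral_const]
  exact integral_mono_of_nonneg (Eventually.of_forall fun v => (P.rate_pos N i v w).le)
    (integrable_const _) (Eventually.of_forall fun v => P.rate_le_one N i v w)

/-- `0 ≤ m_i`. [folklore] -/
theorem mass_nonneg (i : Fin N) (w : Conf d N) : 0 ≤ P.mass N i w :=
  integral_nonneg fun v => (P.rate_pos N i v w).le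

/-- `m_i` is measurable. [folklore] -/
theorem measurable_mass (i : Fin N) : Measurable (P.mass N i) :=
  ((P.measurable_rate N i).stronglyMeasurable.integral_prod_right' (ν := P.μ₀)).measurable

/-- **`ε₂`-bound** (BCDP 2006 Cor. 5.2): `∫_Λ (1 - e^{-βφ(z-v)}) dv ≤ ε(β)`. [cite: BoudouCaputoDaiPraPosta2006, §5 Cor. 5.2] -/
theorem integral_one_sub_epair_le (p : Conf d N × Pt d) :
    ∫ v, (1 - P.epair N (p, v)) ∂P.μ₀ ≤ P.ε :=
  P.integral_oneSubExp_sub_le p.2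

end GasModel

end EpsBounds

/-! ### The Bochner identity and the Bakry–Émery estimate `‖A f‖² ≥ (1 - 3(N-1)ε/|Λ|) ℰ(f,f)` -/

section Estimate

variable {d N : ℕ}

/-! #### Bounded measurable bookkeeping -/

/-- Products of bounded functions are bounded. [folklore] -/
theorem exists_bound_mul {X : Type*} {F G : X → ℝ} (hF : ∃ C, ∀ x, |F x| ≤ C)
    (hG : ∃ C, ∀ x, |G x| ≤ C) : ∃ C, ∀ x, |F x * G x| ≤ C := by
  obtain ⟨A, hA⟩ := hF; obtain ⟨B, hB⟩ := hG
  refine ⟨A * B, fun x => ?_⟩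
  rw [abs_mul]
  exact mul_le_mul (hA x) (hB x) (abs_nonneg _) ((abs_nonneg _).trans (hA x))

/-- Differences of bounded functions are bounded. [folklore] -/
theorem exists_bound_sub {X : Type*} {F G : X → ℝ} (hF : ∃ C, ∀ x, |F x| ≤ C)
    (hG : ∃ C, ∀ x, |G x| ≤ C) : ∃ C, ∀ x, |F x - G x| ≤ C := by
  obtain ⟨A, hA⟩ := hF; obtain ⟨B, hB⟩ := hG
  exact ⟨A + B, fun x => (abs_sub _ _).trans (add_le_add (hA x) (hB x))⟩

/-- Sums of bounded functions are bounded. [folklore] -/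
theorem exists_bound_add {X : Type*} {F G : X → ℝ} (hF : ∃ C, ∀ x, |F x| ≤ C)
    (hG : ∃ C, ∀ x, |G x| ≤ C) : ∃ C, ∀ x, |F x + G x| ≤ C := by
  obtain ⟨A, hA⟩ := hF; obtain ⟨B, hB⟩ := hG
  exact ⟨A + B, fun x => (abs_add_le _ _).trans (add_le_add (hA x) (hB x))⟩

/-- A bounded function precomposed with anything is bounded. [folklore] -/
theorem exists_bound_comp {X Y : Type*} {F : X → ℝ} (hF : ∃ C, ∀ x, |F x| ≤ C) (g : Y → X) :
    ∃ C, ∀ y, |F (g y)| ≤ C := by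
  obtain ⟨A, hA⟩ := hF; exact ⟨A, fun y => hA _⟩

/-- Bounded measurable functions on finite measure spaces are integrable. [folklore] -/
theorem integrable_of_exists_bound {X : Type*} [MeasurableSpace X] {μ : Measure X} [IsFiniteMeasure μ]
    {F : X → ℝ} (hm : Measurable F) (hb : ∃ C, ∀ x, |F x| ≤ C) : Integrable F μ := by
  obtain ⟨C, hC⟩ := hb; exact integrable_of_bdd hm C hC

/-! #### The four evaluations `f(w), f(w^{i→z}), f(w^{j→v}), f((w^{i→z})^{j→v})` -/

/-- `a = f(w)`. [folklore] -/
def fa (f : Conf d N → ℝ) (q : (Conf d N × Pt d) × Pt d) : ℝ := f q.1.1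
/-- `b = f(w^{i→z})`. [folklore] -/
def fb (i : Fin N) (f : Conf d N → ℝ) (q : (Conf d N × Pt d) × Pt d) : ℝ := f (update q.1.1 i q.1.2)
/-- `c = f(w^{j→v})`. [folklore] -/
def fc (j : Fin N) (f : Conf d N → ℝ) (q : (Conf d N × Pt d) × Pt d) : ℝ := f (update q.1.1 j q.2)
/-- `d = f((w^{i→z})^{j→v})`. [folklore] -/
def fd (i j : Fin N) (f : Conf d N → ℝ) (q : (Conf d N × Pt d) × Pt d) : ℝ :=
  f (update (update q.1.1 i q.1.2) j q.2)
/-- The double increment `∇_{xz}∇_{yv} f = a - b - c + d`. [cite: BoudouCaputoDaiPraPosta2006, §2 Lemma 2.1] -/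
def fu (i j : Fin N) (f : Conf d N → ℝ) (q : (Conf d N × Pt d) × Pt d) : ℝ :=
  fa f q - fb i f q - fc j f q + fd i j f q

section Algebra

variable (i j : Fin N) (f : Conf d N → ℝ) (q : (Conf d N × Pt d) × Pt d)

/-- `a ∘ τ_i = b`. [folklore] -/
theorem fa_swapUpdFst : fa f (swapUpdFst i q) = fb i f q := rfl

/-- `b ∘ τ_i = a`. [folklore] -/
theorem fb_swapUpdFst : fb i f (swapUpdFst i q) = fa f q := by
  simp only [fb, fa, swapUpdFst_apply, swapUpd_fst, swapUpd_snd, update_idem, update_eq_self]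

/-- `c ∘ τ_i = d`. [folklore] -/
theorem fc_swapUpdFst : fc j f (swapUpdFst i q) = fd i j f q := rfl

/-- `d ∘ τ_i = c`. [folklore] -/
theorem fd_swapUpdFst : fd i j f (swapUpdFst i q) = fc j f q := by
  simp only [fd, fc, swapUpdFst_apply, swapUpd_fst, swapUpd_snd, update_idem, update_eq_self]

/-- The double increment is odd under `τ_i`. [folklore] -/
theorem fu_swapUpdFst : fu i j f (swapUpdFst i q) = -fu i j f q := by
  simp only [fu, fa_swapUpdFst, fb_swapUpdFst, fc_swapUpdFst, fd_swapUpdFst]; ring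

/-- `a` is `swap₂`-invariant. [folklore] -/
theorem fa_swap₂ : fa f (swap₂ q) = fa f q := rfl

/-- `b_i ∘ swap₂ = c_i`. [folklore] -/
theorem fb_swap₂ : fb i f (swap₂ q) = fc i f q := rfl

/-- `c_j ∘ swap₂ = b_j`. [folklore] -/
theorem fc_swap₂ : fc j f (swap₂ q) = fb j f q := rfl

variable {i j} in
/-- `d_{ij} ∘ swap₂ = d_{ji}` (**(A2)**: moves of distinct particles commute). [cite: BoudouCaputoDaiPraPosta2006, §5 Lemma 5.1] -/
theorem fd_swap₂ (hij : i ≠ j) : fd i j f (swap₂ q) = fd j i f q := by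
  simp only [fd, swap₂_apply]
  rw [update_comm hij]

variable {i j} in
/-- The double increment is symmetric: `u_{ij} ∘ swap₂ = u_{ji}`. [folklore] -/
theorem fu_swap₂ (hij : i ≠ j) : fu i j f (swap₂ q) = fu j i f q := by
  simp only [fu, fa_swap₂, fb_swap₂, fc_swap₂, fd_swap₂ f q hij]; ring

end Algebra

section Meas

variable {f : Conf d N → ℝ} (hfm : Measurable f) (i j : Fin N)
include hfm

/-- `a` is measurable. [folklore] -/
theorem measurable_fa : Measurable (fa f : (Conf d N × Pt d) × Pt d → ℝ) :=
  hfm.comp (measurable_fst.comp measurable_fst)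

/-- `b` is measurable. [folklore] -/
theorem measurable_fb : Measurable (fb i f : (Conf d N × Pt d) × Pt d → ℝ) :=
  hfm.comp (measurable_update'.comp measurable_fst)

/-- `c` is measurable. [folklore] -/
theorem measurable_fc : Measurable (fc j f : (Conf d N × Pt d) × Pt d → ℝ) :=
  hfm.comp (measurable_update'.comp ((measurable_fst.comp measurable_fst).prodMk measurable_snd))

/-- `d` is measurable. [folklore] -/
theorem measurable_fd : Measurable (fd i j f : (Conf d N × Pt d) × Pt d → ℝ) :=
  hfm.comp (measurable_update'.comp
    ((measurable_update'.comp measurable_fst).prodMk measurable_snd))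

/-- `u` is measurable. [folklore] -/
theorem measurable_fu : Measurable (fu i j f : (Conf d N × Pt d) × Pt d → ℝ) :=
  (((measurable_fa hfm).sub (measurable_fb hfm i)).sub (measurable_fc hfm j)).add (measurable_fd hfm i j)

end Meas

section Bdd

variable {f : Conf d N → ℝ} (hb : ∃ C, ∀ w, |f w| ≤ C) (i j : Fin N)
include hb

/-- `a` is bounded. [folklore] -/
theorem bdd_fa : ∃ C, ∀ q : (Conf d N × Pt d) × Pt d, |fa f q| ≤ C := exists_bound_comp hb _
/-- `b` is bounded. [folklore] -/
theorem bdd_fb : ∃ C, ∀ q : (Conf d N × Pt d) × Pt d, |fb i f q| ≤ C := exists_bound_comp hb _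
/-- `c` is bounded. [folklore] -/
theorem bdd_fc : ∃ C, ∀ q : (Conf d N × Pt d) × Pt d, |fc j f q| ≤ C := exists_bound_comp hb _
/-- `d` is bounded. [folklore] -/
theorem bdd_fd : ∃ C, ∀ q : (Conf d N × Pt d) × Pt d, |fd i j f q| ≤ C := exists_bound_comp hb _
/-- `u` is bounded. [folklore] -/
theorem bdd_fu : ∃ C, ∀ q : (Conf d N × Pt d) × Pt d, |fu i j f q| ≤ C :=
  exists_bound_add (exists_bound_sub (exists_bound_sub (bdd_fa hb) (bdd_fb hb i)) (bdd_fc hb j))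
    (bdd_fd hb i j)

end Bdd

namespace GasModel

variable (P : GasModel d) (N)

/-! #### From `∫ G_i · g dν` to `R_i`-integrals -/

/-- `∫ ∇̃_i f · (g ∘ fst) dR_i = ∫ g · G_i f dν` for bounded measurable `f, g`. [folklore] -/
theorem integral_mgrad_mul_comp_fst (i : Fin N) {f g : Conf d N → ℝ} (hfm : Measurable f)
    (hfb : ∃ C, ∀ w, |f w| ≤ C) (hgm : Measurable g) (hgb : ∃ C, ∀ w, |g w| ≤ C) :
    ∫ p, mgrad i f p * g p.1 ∂P.R N i = ∫ w, g w * P.sliceGen N i f w ∂P.ν N := by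
  obtain ⟨Cf, hCf⟩ := hfb
  obtain ⟨Cg, hCg⟩ := hgb
  rw [P.integral_R N i]
  have hint : Integrable (fun p : Conf d N × Pt d => P.rate N i p.2 p.1 • (mgrad i f p * g p.1))
      ((P.ν N).prod P.μ₀) := by
    refine integrable_of_bdd (((P.measurable_rate N i).smul (((hfm.comp measurable_fst).sub
      (hfm.comp measurable_update')).mul (hgm.comp measurable_fst)))) (2 * Cf * Cg) fun p => ?_
    rw [smul_eq_mul, ← mul_assoc, abs_mul]
    exact mul_le_mul (P.abs_rate_mul_mgrad_le N i hCf p) (hCg _) (abs_nonneg _)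
      (by linarith [abs_nonneg (P.rate N i p.2 p.1 * mgrad i f p), P.abs_rate_mul_mgrad_le N i hCf p])
  rw [integral_prod _ hint]
  refine integral_congr_ae (Eventually.of_forall fun w => ?_)
  simp only [sliceGen]
  rw [← integral_const_mul]
  refine integral_congr_ae (Eventually.of_forall fun z => ?_)
  simp only [smul_eq_mul]; ring

/-- `G_i f` is bounded. [folklore] -/
theorem bdd_sliceGen (i : Fin N) {f : Conf d N → ℝ} (hfb : ∃ C, ∀ w, |f w| ≤ C) :
    ∃ C, ∀ w, |P.sliceGen N i f w| ≤ C := by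
  obtain ⟨C, hC⟩ := hfb; exact ⟨2 * C * P.vol, P.abs_sliceGen_le N i hC⟩

/-! #### The diagonal term (BCDP 2006 (5.5)) -/

/-- `G_i f (w) - G_i f (w^{i→z}) = m_i(w) ∇̃_{iz} f (w)`. [folklore] -/
theorem sliceGen_sub_sliceGen_update (i : Fin N) {f : Conf d N → ℝ} (hfm : Measurable f)
    (hfb : ∃ C, ∀ w, |f w| ≤ C) (p : Conf d N × Pt d) :
    P.sliceGen N i f p.1 - P.sliceGen N i f (update p.1 i p.2) = P.mass N i p.1 * mgrad i f p := by
  obtain ⟨C, hC⟩ := hfb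
  have hint : ∀ w : Conf d N, Integrable (fun v => P.rate N i v w * mgrad i f (w, v)) P.μ₀ := by
    intro w
    have hm : Measurable fun v => P.rate N i v w * mgrad i f (w, v) := by
      have h := (P.measurable_rate_mul_mgrad N i hfm).comp (measurable_prodMk_left (x := w))
      exact h
    exact integrable_of_bdd hm (2 * C) fun v => P.abs_rate_mul_mgrad_le N i hC (w, v)
  simp only [sliceGen, mass]
  rw [← integral_sub (hint _) (hint _), ← integral_mul_const]
  refine integral_congr_ae (Eventually.of_forall fun v => ?_)
  simp only [mgrad, rate_update, update_idem]
  ring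

/-- **The diagonal term** `A` of BCDP 2006 §5: `2 ∫ (G_i f)² dν = ∫ m_i(w) (∇̃_i f)² dR_i`
((5.5): "`A = N/(2Z|Λ|^{N+1}) ∫∫ e^{…} (∇_{w₁z} f)² ∫ dv/|Λ| e^{-β(H^{w₁v}-H^{w₁-})}`").
[cite: BoudouCaputoDaiPraPosta2006, §5 (5.5)] -/
theorem two_mul_integral_sliceGen_sq (i : Fin N) {f : Conf d N → ℝ} (hfm : Measurable f)
    (hfb : ∃ C, ∀ w, |f w| ≤ C) :
    2 * ∫ w, P.sliceGen N i f w ^ 2 ∂P.ν N = ∫ p, P.mass N i p.1 * mgrad i f p ^ 2 ∂P.R N i := by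
  have hGm := P.measurable_sliceGen N i hfm
  have hGb := P.bdd_sliceGen N i hfb
  have hmgm : Measurable (mgrad i f) := (hfm.comp measurable_fst).sub (hfm.comp measurable_update')
  have hmgb : ∃ C, ∀ p : Conf d N × Pt d, |mgrad i f p| ≤ C := by
    obtain ⟨C, hC⟩ := hfb; exact ⟨2 * C, abs_mgrad_le i hC⟩
  have h1 : ∫ w, P.sliceGen N i f w ^ 2 ∂P.ν N = ∫ p, mgrad i f p * P.sliceGen N i f p.1 ∂P.R N i := by
    rw [P.integral_mgrad_mul_comp_fst N i hfm hfb hGm hGb]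
    exact integral_congr_ae (Eventually.of_forall fun w => by simp only [sq])
  have h2 : ∫ p, mgrad i f p * P.sliceGen N i f p.1 ∂P.R N i =
      -∫ p, mgrad i f p * P.sliceGen N i f (update p.1 i p.2) ∂P.R N i := by
    rw [← P.integral_comp_swapUpd N i (fun p => mgrad i f p * P.sliceGen N i f p.1), ← integral_neg]
    refine integral_congr_ae (Eventually.of_forall fun p => ?_)
    simp only [mgrad_swapUpd, swapUpd_fst]; ring
  have hi1 : Integrable (fun p => mgrad i f p * P.sliceGen N i f p.1) (P.R N i) :=
    integrable_of_exists_bound (hmgm.mul (hGm.comp measurable_fst)) (exists_bound_mul hmgb (exists_bound_comp hGb _))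
  have hi2 : Integrable (fun p => mgrad i f p * P.sliceGen N i f (update p.1 i p.2)) (P.R N i) :=
    integrable_of_exists_bound (hmgm.mul (hGm.comp measurable_update'))
      (exists_bound_mul hmgb (exists_bound_comp hGb _))
  calc 2 * ∫ w, P.sliceGen N i f w ^ 2 ∂P.ν N
      = ∫ p, mgrad i f p * P.sliceGen N i f p.1 ∂P.R N i -
          ∫ p, mgrad i f p * P.sliceGen N i f (update p.1 i p.2) ∂P.R N i := by rw [h1, two_mul, h2]; ring
    _ = ∫ p, (mgrad i f p * P.sliceGen N i f p.1 - mgrad i f p * P.sliceGen N i f (update p.1 i p.2))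
          ∂P.R N i := (integral_sub hi1 hi2).symm
    _ = _ := by
        refine integral_congr_ae (Eventually.of_forall fun p => ?_)
        dsimp only
        rw [← mul_sub, P.sliceGen_sub_sliceGen_update N i hfm hfb p, sq]; ring

/-- **Lower bound for the diagonal term** (BCDP 2006 (5.6)): `2 ∫ (G_i f)² dν ≥ (|Λ| - (N-1)ε) ℰ_i(f,f)`.
[cite: BoudouCaputoDaiPraPosta2006, §5 (5.6)] -/
theorem integral_sliceGen_sq_ge (i : Fin N) {f : Conf d N → ℝ} (hfm : Measurable f)
    (hfb : ∃ C, ∀ w, |f w| ≤ C) :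
    (P.vol - ((N - 1 : ℕ) : ℝ) * P.ε) * P.formᵢ N i f f ≤ 2 * ∫ w, P.sliceGen N i f w ^ 2 ∂P.ν N := by
  rw [P.two_mul_integral_sliceGen_sq N i hfm hfb, formᵢ, ← integral_const_mul]
  have hmgm : Measurable (mgrad i f) := (hfm.comp measurable_fst).sub (hfm.comp measurable_update')
  have hmgb : ∃ C, ∀ p : Conf d N × Pt d, |mgrad i f p| ≤ C := by
    obtain ⟨C, hC⟩ := hfb; exact ⟨2 * C, abs_mgrad_le i hC⟩
  refine integral_mono ?_ ?_ fun p => ?_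
  · exact (integrable_of_exists_bound (hmgm.mul hmgm) (exists_bound_mul hmgb hmgb)).const_mul _
  · refine integrable_of_exists_bound (((P.measurable_mass N i).comp measurable_fst).mul (hmgm.pow_const 2)) ?_
    refine exists_bound_mul ⟨P.vol, fun p => ?_⟩ ?_
    · rw [abs_of_nonneg (P.mass_nonneg N i _)]; exact P.mass_le_vol N i _
    · obtain ⟨C, hC⟩ := hmgb
      exact ⟨C ^ 2, fun p => by rw [abs_pow]; exact pow_le_pow_left₀ (abs_nonneg _) (hC p) 2⟩
  · have : mgrad i f p * mgrad i f p = mgrad i f p ^ 2 := (sq _).symm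
    rw [this]
    exact mul_le_mul_of_nonneg_right (P.vol_sub_le_mass N i p.1) (sq_nonneg _)

/-! #### The off-diagonal term: `∫ G_i G_j dν = C_{ij} + B_{ij}` -/

/-- `∫ G_i f · G_j f dν = ∫ (a - b)(a - c) dT_{ij}`. [cite: BoudouCaputoDaiPraPosta2006, §5 (proof of Thm 5.1)] -/
theorem integral_sliceGen_mul_sliceGen (i j : Fin N) {f : Conf d N → ℝ} (hfm : Measurable f)
    (hfb : ∃ C, ∀ w, |f w| ≤ C) :
    ∫ w, P.sliceGen N i f w * P.sliceGen N j f w ∂P.ν N =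
      ∫ q, (fa f q - fb i f q) * (fa f q - fc j f q) ∂P.T₂ N i j := by
  have hGm := P.measurable_sliceGen N j hfm
  have hGb := P.bdd_sliceGen N j hfb
  rw [show (fun w => P.sliceGen N i f w * P.sliceGen N j f w) =
      fun w => P.sliceGen N j f w * P.sliceGen N i f w from funext fun w => mul_comm _ _,
    ← P.integral_mgrad_mul_comp_fst N i hfm hfb hGm hGb, P.integral_T₂ N i j]
  · refine integral_congr_ae (Eventually.of_forall fun p => ?_)
    simp only [sliceGen]
    rw [← integral_const_mul]
    refine integral_congr_ae (Eventually.of_forall fun v => ?_)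
    simp only [fa, fb, fc, mgrad]; ring
  · -- integrability on `R_i ⊗ dv`
    haveI : IsFiniteMeasure ((P.R N i).prod P.μ₀) := by infer_instance
    refine integrable_of_exists_bound ?_ ?_
    · exact ((P.measurable_rate N j).comp ((measurable_fst.comp measurable_fst).prodMk measurable_snd)).mul
        (((measurable_fa hfm).sub (measurable_fb hfm i)).mul ((measurable_fa hfm).sub (measurable_fc hfm j)))
    · refine exists_bound_mul ⟨1, fun q => ?_⟩ (exists_bound_mul (exists_bound_sub (bdd_fa hfb) (bdd_fb hfb i))
        (exists_bound_sub (bdd_fa hfb) (bdd_fc hfb j)))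
      rw [abs_of_pos (P.rate_pos N j _ _)]; exact P.rate_le_one N j _ _

/-- The split `1 = e^{-βφ(z-v)} + (1 - e^{-βφ(z-v)})` of the off-diagonal term:
`∫ G_i G_j dν = C_{ij} + B_{ij}` with `C_{ij} = ∫ (a-b)(a-c) dR_{ij}`. [cite: BoudouCaputoDaiPraPosta2006, §5 (proof of Thm 5.1)] -/
theorem integral_sliceGen_mul_sliceGen_split (i j : Fin N) {f : Conf d N → ℝ} (hfm : Measurable f)
    (hfb : ∃ C, ∀ w, |f w| ≤ C) :
    ∫ w, P.sliceGen N i f w * P.sliceGen N j f w ∂P.ν N =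
      ∫ q, (fa f q - fb i f q) * (fa f q - fc j f q) ∂P.R₂ N i j +
        ∫ q, (1 - P.epair N q) * ((fa f q - fb i f q) * (fa f q - fc j f q)) ∂P.T₂ N i j := by
  rw [P.integral_sliceGen_mul_sliceGen N i j hfm hfb, P.integral_R₂ N i j]
  have hFm : Measurable fun q => (fa f q - fb i f q) * (fa f q - fc j f q) :=
    ((measurable_fa hfm).sub (measurable_fb hfm i)).mul ((measurable_fa hfm).sub (measurable_fc hfm j))
  have hFb : ∃ C, ∀ q, |(fa f q - fb i f q) * (fa f q - fc j f q)| ≤ C :=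
    exists_bound_mul (exists_bound_sub (bdd_fa hfb) (bdd_fb hfb i)) (exists_bound_sub (bdd_fa hfb) (bdd_fc hfb j))
  have he : ∃ C, ∀ q, |P.epair N q| ≤ C :=
    ⟨1, fun q => by rw [abs_of_pos (P.epair_pos N q)]; exact P.epair_le_one N q⟩
  have hI1 : Integrable (fun q => P.epair N q * ((fa f q - fb i f q) * (fa f q - fc j f q))) (P.T₂ N i j) :=
    integrable_of_exists_bound ((P.measurable_epair N).mul hFm) (exists_bound_mul he hFb)
  have hI2 : Integrable (fun q => (1 - P.epair N q) * ((fa f q - fb i f q) * (fa f q - fc j f q))) (P.T₂ N i j) :=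
    integrable_of_exists_bound ((measurable_const.sub (P.measurable_epair N)).mul hFm)
      (exists_bound_mul (exists_bound_sub ⟨1, fun _ => by simp⟩ he) hFb)
  rw [← integral_add hI1 hI2]
  refine integral_congr_ae (Eventually.of_forall fun q => ?_)
  ring

/-! #### The Bochner identity: `C_{ij} ≥ 0` (BCDP 2006 Lemma 2.1) -/

/-- Step 1 (first-slot reversibility (A4)): `∫ (a-b)(a-c) dR_{ij} = ½ ∫ (a-b)(a-b-c+d) dR_{ij}`.
[cite: BoudouCaputoDaiPraPosta2006, §2 Lemma 2.1] -/
theorem bochner_step1 (i j : Fin N) (hij : i ≠ j) {f : Conf d N → ℝ} (hfm : Measurable f)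
    (hfb : ∃ C, ∀ w, |f w| ≤ C) :
    ∫ q, (fa f q - fb i f q) * (fa f q - fc j f q) ∂P.R₂ N i j =
      (1 / 2) * ∫ q, (fa f q - fb i f q) * fu i j f q ∂P.R₂ N i j := by
  have h := P.integral_R₂_comp_swapUpdFst N i j hij (fun q => (fa f q - fb i f q) * (fa f q - fc j f q))
  simp only [fa_swapUpdFst, fb_swapUpdFst, fc_swapUpdFst] at h
  have hI1 : Integrable (fun q => (fa f q - fb i f q) * (fa f q - fc j f q)) (P.R₂ N i j) :=
    integrable_of_exists_bound (((measurable_fa hfm).sub (measurable_fb hfm i)).mul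
      ((measurable_fa hfm).sub (measurable_fc hfm j)))
      (exists_bound_mul (exists_bound_sub (bdd_fa hfb) (bdd_fb hfb i)) (exists_bound_sub (bdd_fa hfb) (bdd_fc hfb j)))
  have hI2 : Integrable (fun q => (fb i f q - fa f q) * (fb i f q - fd i j f q)) (P.R₂ N i j) :=
    integrable_of_exists_bound (((measurable_fb hfm i).sub (measurable_fa hfm)).mul
      ((measurable_fb hfm i).sub (measurable_fd hfm i j)))
      (exists_bound_mul (exists_bound_sub (bdd_fb hfb i) (bdd_fa hfb)) (exists_bound_sub (bdd_fb hfb i) (bdd_fd hfb i j)))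
  have hsum : ∫ q, (fa f q - fb i f q) * fu i j f q ∂P.R₂ N i j =
      ∫ q, (fa f q - fb i f q) * (fa f q - fc j f q) ∂P.R₂ N i j +
        ∫ q, (fb i f q - fa f q) * (fb i f q - fd i j f q) ∂P.R₂ N i j := by
    rw [← integral_add hI1 hI2]
    refine integral_congr_ae (Eventually.of_forall fun q => ?_)
    simp only [fu]; ring
  rw [hsum, h]; ring

/-- Step 2 (symmetry (A3) + reversibility (A4) for particle `j`):
`∫ (a-b)(a-b-c+d) dR_{ij} = ½ ∫ (a-b-c+d)² dR_{ji}`. [cite: BoudouCaputoDaiPraPosta2006, §2 Lemma 2.1] -/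
theorem bochner_step2 (i j : Fin N) (hij : i ≠ j) {f : Conf d N → ℝ} (hfm : Measurable f)
    (hfb : ∃ C, ∀ w, |f w| ≤ C) :
    ∫ q, (fa f q - fb i f q) * fu i j f q ∂P.R₂ N i j =
      (1 / 2) * ∫ q, fu j i f q ^ 2 ∂P.R₂ N j i := by
  -- transfer to `R_{ji}`
  have h1 := P.integral_R₂_comp_swap₂ N i j (fun q => (fa f q - fb i f q) * fu i j f q)
  simp only [fa_swap₂, fb_swap₂, fu_swap₂ f _ hij] at h1
  rw [← h1]
  -- first-slot exchange on `R_{ji}`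
  have h2 := P.integral_R₂_comp_swapUpdFst N j i hij.symm (fun q => (fa f q - fc i f q) * fu j i f q)
  simp only [fa_swapUpdFst, fc_swapUpdFst, fu_swapUpdFst] at h2
  have hI1 : Integrable (fun q => (fa f q - fc i f q) * fu j i f q) (P.R₂ N j i) :=
    integrable_of_exists_bound (((measurable_fa hfm).sub (measurable_fc hfm i)).mul (measurable_fu hfm j i))
      (exists_bound_mul (exists_bound_sub (bdd_fa hfb) (bdd_fc hfb i)) (bdd_fu hfb j i))
  have hI2 : Integrable (fun q => (fb j f q - fd j i f q) * -fu j i f q) (P.R₂ N j i) :=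
    integrable_of_exists_bound (((measurable_fb hfm j).sub (measurable_fd hfm j i)).mul (measurable_fu hfm j i).neg)
      (exists_bound_mul (exists_bound_sub (bdd_fb hfb j) (bdd_fd hfb j i))
        (by obtain ⟨C, hC⟩ := bdd_fu hfb j i; exact ⟨C, fun q => by rw [abs_neg]; exact hC q⟩))
  have hsum : ∫ q, fu j i f q ^ 2 ∂P.R₂ N j i =
      ∫ q, (fa f q - fc i f q) * fu j i f q ∂P.R₂ N j i +
        ∫ q, (fb j f q - fd j i f q) * -fu j i f q ∂P.R₂ N j i := by
    rw [← integral_add hI1 hI2]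
    refine integral_congr_ae (Eventually.of_forall fun q => ?_)
    simp only [fu]; ring
  rw [hsum, h2]; ring

/-- **Bochner positivity** (BCDP 2006 Lemma 2.1 / Cor. 2.1 for the continuum gas):
`C_{ij} = ¼ ∫ (∇_{xz}∇_{yv} f)² dR ≥ 0`. [cite: BoudouCaputoDaiPraPosta2006, §2 Lemma 2.1] -/
theorem bochner_nonneg (i j : Fin N) (hij : i ≠ j) {f : Conf d N → ℝ} (hfm : Measurable f)
    (hfb : ∃ C, ∀ w, |f w| ≤ C) :
    0 ≤ ∫ q, (fa f q - fb i f q) * (fa f q - fc j f q) ∂P.R₂ N i j := by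
  rw [P.bochner_step1 N i j hij hfm hfb, P.bochner_step2 N i j hij hfm hfb]
  have : 0 ≤ ∫ q, fu j i f q ^ 2 ∂P.R₂ N j i := integral_nonneg fun q => sq_nonneg _
  positivity

/-! #### The error term `B_{ij}` (BCDP 2006, end of proof of Thm 5.1) -/

/-- `X_{ij} = ∫ (1 - e^{-βφ(z-v)}) (a-b)² dT_{ij} ≤ ε ℰ_i(f, f)`. [cite: BoudouCaputoDaiPraPosta2006, §5 (proof of Thm 5.1)] -/
theorem integral_oneSub_epair_mul_sq_le (i j : Fin N) {f : Conf d N → ℝ} (hfm : Measurable f)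
    (hfb : ∃ C, ∀ w, |f w| ≤ C) :
    ∫ q, (1 - P.epair N q) * (fa f q - fb i f q) ^ 2 ∂P.T₂ N i j ≤ P.ε * P.formᵢ N i f f := by
  have hmgm : Measurable (mgrad i f) := (hfm.comp measurable_fst).sub (hfm.comp measurable_update')
  have hmgb : ∃ C, ∀ p : Conf d N × Pt d, |mgrad i f p| ≤ C := by
    obtain ⟨C, hC⟩ := hfb; exact ⟨2 * C, abs_mgrad_le i hC⟩
  have he1 : ∀ q, 0 ≤ 1 - P.epair N q := fun q => sub_nonneg.2 (P.epair_le_one N q)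
  haveI : IsFiniteMeasure ((P.R N i).prod P.μ₀) := by infer_instance
  rw [P.integral_T₂ N i j]
  · -- inner integral bound, pointwise in `p`
    have hinner : ∀ p : Conf d N × Pt d,
        ∫ v, P.rate N j v p.1 * ((1 - P.epair N (p, v)) * (fa f (p, v) - fb i f (p, v)) ^ 2) ∂P.μ₀ ≤
          P.ε * mgrad i f p ^ 2 := by
      intro p
      have hid : ∀ v, P.rate N j v p.1 * ((1 - P.epair N (p, v)) * (fa f (p, v) - fb i f (p, v)) ^ 2) =
          mgrad i f p ^ 2 * (P.rate N j v p.1 * (1 - P.epair N (p, v))) := fun v => by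
        simp only [fa, fb, mgrad]; ring
      simp_rw [hid]
      rw [integral_const_mul, mul_comm]
      refine mul_le_mul_of_nonneg_right ?_ (sq_nonneg _)
      have hint1 : Integrable (fun v => 1 - P.epair N (p, v)) P.μ₀ :=
        integrable_of_bdd (measurable_const.sub ((P.measurable_epair N).comp measurable_prodMk_left)) 1
          fun v => by rw [abs_of_nonneg (he1 _)]; linarith [P.epair_pos N (p, v)]
      calc ∫ v, P.rate N j v p.1 * (1 - P.epair N (p, v)) ∂P.μ₀ ≤ ∫ v, (1 - P.epair N (p, v)) ∂P.μ₀ := by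
            refine integral_mono_of_nonneg (Eventually.of_forall fun v =>
              mul_nonneg (P.rate_pos N j _ _).le (he1 _)) hint1 (Eventually.of_forall fun v => ?_)
            exact mul_le_of_le_one_left (he1 _) (P.rate_le_one N j _ _)
        _ ≤ P.ε := P.integral_one_sub_epair_le N p
    calc ∫ p, ∫ v, P.rate N j v p.1 * ((1 - P.epair N (p, v)) * (fa f (p, v) - fb i f (p, v)) ^ 2) ∂P.μ₀ ∂P.R N i
        ≤ ∫ p, P.ε * mgrad i f p ^ 2 ∂P.R N i := by
          refine integral_mono_of_nonneg (Eventually.of_forall fun p => integral_nonneg fun v =>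
            mul_nonneg (P.rate_pos N j _ _).le (mul_nonneg (he1 _) (sq_nonneg _))) ?_
            (Eventually.of_forall hinner)
          exact (integrable_of_exists_bound (hmgm.pow_const 2) (by
            obtain ⟨C, hC⟩ := hmgb
            exact ⟨C ^ 2, fun p => by rw [abs_pow]; exact pow_le_pow_left₀ (abs_nonneg _) (hC p) 2⟩)).const_mul _
      _ = P.ε * P.formᵢ N i f f := by
          rw [integral_const_mul, formᵢ]
          congr 1
          exact integral_congr_ae (Eventually.of_forall fun p => sq _)
  · refine integrable_of_exists_bound ?_ ?_
    · exact ((P.measurable_rate N j).comp ((measurable_fst.comp measurable_fst).prodMk measurable_snd)).mul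
        ((measurable_const.sub (P.measurable_epair N)).mul (((measurable_fa hfm).sub (measurable_fb hfm i)).pow_const 2))
    · refine exists_bound_mul ⟨1, fun q => ?_⟩ (exists_bound_mul ⟨1, fun q => ?_⟩ ?_)
      · rw [abs_of_pos (P.rate_pos N j _ _)]; exact P.rate_le_one N j _ _
      · rw [abs_of_nonneg (he1 _)]; linarith [P.epair_pos N q]
      · obtain ⟨C, hC⟩ := exists_bound_sub (bdd_fa hfb) (bdd_fb hfb i)
        exact ⟨C ^ 2, fun q => by rw [abs_pow]; exact pow_le_pow_left₀ (abs_nonneg _) (hC q) 2⟩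

/-- `Y_{ij} = ∫ (1 - e^{-βφ(z-v)}) (a-c)² dT_{ij} = X_{ji} ≤ ε ℰ_j(f, f)` (symmetry `z ↔ v`).
[cite: BoudouCaputoDaiPraPosta2006, §5 (proof of Thm 5.1)] -/
theorem integral_oneSub_epair_mul_sq_le' (i j : Fin N) {f : Conf d N → ℝ} (hfm : Measurable f)
    (hfb : ∃ C, ∀ w, |f w| ≤ C) :
    ∫ q, (1 - P.epair N q) * (fa f q - fc j f q) ^ 2 ∂P.T₂ N i j ≤ P.ε * P.formᵢ N j f f := by
  have h := P.integral_T₂_comp_swap₂ N i j (fun q => (1 - P.epair N q) * (fa f q - fc j f q) ^ 2)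
  simp only [epair_swap₂, fa_swap₂, fc_swap₂] at h
  rw [← h]
  exact P.integral_oneSub_epair_mul_sq_le N j i hfm hfb

/-- **The `B`-term bound**: `|B_{ij}| ≤ ε/2 · (ℰ_i(f,f) + ℰ_j(f,f))`
(BCDP 2006: "`|∇_{w₁z}f ∇_{w₂v}f| ≤ ½[(∇_{w₁z}f)² + (∇_{w₂v}f)²]` and `e^{-β(H^{w₂v}-H^{w₂-})} ≤ 1`").
[cite: BoudouCaputoDaiPraPosta2006, §5 (proof of Thm 5.1)] -/
theorem abs_Bterm_le (i j : Fin N) {f : Conf d N → ℝ} (hfm : Measurable f) (hfb : ∃ C, ∀ w, |f w| ≤ C) :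
    |∫ q, (1 - P.epair N q) * ((fa f q - fb i f q) * (fa f q - fc j f q)) ∂P.T₂ N i j| ≤
      P.ε / 2 * (P.formᵢ N i f f + P.formᵢ N j f f) := by
  have he1 : ∀ q, 0 ≤ 1 - P.epair N q := fun q => sub_nonneg.2 (P.epair_le_one N q)
  have hX := P.integral_oneSub_epair_mul_sq_le N i j hfm hfb
  have hY := P.integral_oneSub_epair_mul_sq_le' N i j hfm hfb
  have hbe : ∃ C, ∀ q, |1 - P.epair N q| ≤ C := ⟨1, fun q => by
    rw [abs_of_nonneg (he1 _)]; linarith [P.epair_pos N q]⟩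
  have hsq : ∀ {F : (Conf d N × Pt d) × Pt d → ℝ}, (∃ C, ∀ q, |F q| ≤ C) → ∃ C, ∀ q, |F q ^ 2| ≤ C :=
    fun ⟨C, hC⟩ => ⟨C ^ 2, fun q => by rw [abs_pow]; exact pow_le_pow_left₀ (abs_nonneg _) (hC q) 2⟩
  have hIX : Integrable (fun q => (1 - P.epair N q) * (fa f q - fb i f q) ^ 2) (P.T₂ N i j) :=
    integrable_of_exists_bound ((measurable_const.sub (P.measurable_epair N)).mul
      (((measurable_fa hfm).sub (measurable_fb hfm i)).pow_const 2))
      (exists_bound_mul hbe (hsq (exists_bound_sub (bdd_fa hfb) (bdd_fb hfb i))))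
  have hIY : Integrable (fun q => (1 - P.epair N q) * (fa f q - fc j f q) ^ 2) (P.T₂ N i j) :=
    integrable_of_exists_bound ((measurable_const.sub (P.measurable_epair N)).mul
      (((measurable_fa hfm).sub (measurable_fc hfm j)).pow_const 2))
      (exists_bound_mul hbe (hsq (exists_bound_sub (bdd_fa hfb) (bdd_fc hfb j))))
  calc |∫ q, (1 - P.epair N q) * ((fa f q - fb i f q) * (fa f q - fc j f q)) ∂P.T₂ N i j|
      ≤ ∫ q, |(1 - P.epair N q) * ((fa f q - fb i f q) * (fa f q - fc j f q))| ∂P.T₂ N i j :=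
        abs_integral_le_integral_abs
    _ ≤ ∫ q, (1 / 2) * ((1 - P.epair N q) * (fa f q - fb i f q) ^ 2 +
          (1 - P.epair N q) * (fa f q - fc j f q) ^ 2) ∂P.T₂ N i j := by
        refine integral_mono_of_nonneg (Eventually.of_forall fun q => abs_nonneg _)
          ((hIX.add hIY).const_mul _) (Eventually.of_forall fun q => ?_)
        dsimp only
        rw [abs_mul, abs_of_nonneg (he1 q), abs_mul]
        have h2 : |fa f q - fb i f q| * |fa f q - fc j f q| ≤
            (1 / 2) * ((fa f q - fb i f q) ^ 2 + (fa f q - fc j f q) ^ 2) := by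
          nlinarith [sq_nonneg (|fa f q - fb i f q| - |fa f q - fc j f q|), sq_abs (fa f q - fb i f q),
            sq_abs (fa f q - fc j f q)]
        nlinarith [he1 q, h2]
    _ = (1 / 2) * (∫ q, (1 - P.epair N q) * (fa f q - fb i f q) ^ 2 ∂P.T₂ N i j +
          ∫ q, (1 - P.epair N q) * (fa f q - fc j f q) ^ 2 ∂P.T₂ N i j) := by
        rw [integral_const_mul, integral_add hIX hIY]
    _ ≤ (1 / 2) * (P.ε * P.formᵢ N i f f + P.ε * P.formᵢ N j f f) := by
        exact mul_le_mul_of_nonneg_left (add_le_add hX hY) (by norm_num)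
    _ = _ := by ring

/-- **The off-diagonal term is bounded below**: `∫ G_i G_j dν ≥ -ε/2 (ℰ_i + ℰ_j)` (`i ≠ j`).
[cite: BoudouCaputoDaiPraPosta2006, §5 (proof of Thm 5.1)] -/
theorem integral_sliceGen_mul_sliceGen_ge (i j : Fin N) (hij : i ≠ j) {f : Conf d N → ℝ}
    (hfm : Measurable f) (hfb : ∃ C, ∀ w, |f w| ≤ C) :
    -(P.ε / 2 * (P.formᵢ N i f f + P.formᵢ N j f f)) ≤ ∫ w, P.sliceGen N i f w * P.sliceGen N j f w ∂P.ν N := by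
  rw [P.integral_sliceGen_mul_sliceGen_split N i j hfm hfb]
  have hC := P.bochner_nonneg N i j hij hfm hfb
  have hB := P.abs_Bterm_le N i j hfm hfb
  have := neg_abs_le (∫ q, (1 - P.epair N q) * ((fa f q - fb i f q) * (fa f q - fc j f q)) ∂P.T₂ N i j)
  linarith

/-! #### Summing up -/

/-- `∫ (A f)² dν = |Λ|⁻² Σ_i Σ_j ∫ G_i G_j dν`. [folklore] -/
theorem integral_negGen_sq (f : Conf d N → ℝ) (hfm : Measurable f) (hfb : ∃ C, ∀ w, |f w| ≤ C) :
    ∫ w, P.negGen N f w ^ 2 ∂P.ν N =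
      P.vol⁻¹ ^ 2 * ∑ i, ∑ j, ∫ w, P.sliceGen N i f w * P.sliceGen N j f w ∂P.ν N := by
  have hint : ∀ i j : Fin N, Integrable (fun w => P.sliceGen N i f w * P.sliceGen N j f w) (P.ν N) :=
    fun i j => integrable_of_exists_bound ((P.measurable_sliceGen N i hfm).mul (P.measurable_sliceGen N j hfm))
      (exists_bound_mul (P.bdd_sliceGen N i hfb) (P.bdd_sliceGen N j hfb))
  have hexp : ∀ w, P.negGen N f w ^ 2 = P.vol⁻¹ ^ 2 * ∑ i, ∑ j, P.sliceGen N i f w * P.sliceGen N j f w := by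
    intro w
    rw [negGen, ← Finset.mul_sum, mul_pow, sq (∑ i, P.sliceGen N i f w), Finset.sum_mul_sum]
  simp_rw [hexp]
  rw [integral_const_mul, integral_finsetSum _ fun i _ => integrable_finsetSum _ fun j _ => hint i j]
  congr 1
  exact Finset.sum_congr rfl fun i _ => integral_finsetSum _ fun j _ => hint i j

/-- Double sums over `j ≠ i` of a function of `j` alone. [folklore] -/
theorem sum_sum_erase_right (g : Fin N → ℝ) :
    ∑ i, ∑ j ∈ Finset.univ.erase i, g j = ((N - 1 : ℕ) : ℝ) * ∑ j, g j := by
  have h : ∀ i : Fin N, ∑ j ∈ Finset.univ.erase i, g j = (∑ j, g j) - g i := fun i => by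
    rw [← Finset.add_sum_erase _ _ (Finset.mem_univ i)]; ring
  simp_rw [h]
  rw [Finset.sum_sub_distrib, Finset.sum_const, Finset.card_univ, Fintype.card_fin, nsmul_eq_mul]
  rcases Nat.eq_zero_or_pos N with hN | hN
  · subst hN; simp
  · rw [Nat.cast_sub hN, Nat.cast_one]; ring

/-- **The Bakry–Émery inequality for the canonical gas** (BCDP 2006 Thm 5.1 with Cor. 5.2, in the
form (BE) of Prop. 2.1): for bounded measurable `f`,
`(1 - 3(N-1)ε(β)/|Λ|) ℰ(f, f) ≤ ν[(𝓛 f)²]`. [cite: BoudouCaputoDaiPraPosta2006, §5 Thm 5.1 and Cor. 5.2] -/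
theorem bakryEmery_estimate {f : Conf d N → ℝ} (hfm : Measurable f) (hfb : ∃ C, ∀ w, |f w| ≤ C) :
    (1 - 3 * ((N : ℝ) - 1) * P.ε / P.vol) * P.form N f f ≤ ∫ w, P.negGen N f w ^ 2 ∂P.ν N := by
  rcases Nat.eq_zero_or_pos N with hN | hN
  · subst hN
    have h0 : P.form 0 f f = 0 := by simp [form]
    rw [h0, mul_zero]
    exact integral_nonneg fun w => sq_nonneg _
  have hcast : ((N : ℝ) - 1) = ((N - 1 : ℕ) : ℝ) := by rw [Nat.cast_sub hN, Nat.cast_one]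
  rw [hcast, P.integral_negGen_sq N f hfm hfb]
  -- split the double sum into diagonal and off-diagonal parts
  have hsplit : ∀ i : Fin N, ∑ j, ∫ w, P.sliceGen N i f w * P.sliceGen N j f w ∂P.ν N =
      ∫ w, P.sliceGen N i f w ^ 2 ∂P.ν N +
        ∑ j ∈ Finset.univ.erase i, ∫ w, P.sliceGen N i f w * P.sliceGen N j f w ∂P.ν N := by
    intro i
    rw [← Finset.add_sum_erase _ _ (Finset.mem_univ i)]
    congr 1
    exact integral_congr_ae (Eventually.of_forall fun w => by simp only [sq])
  simp_rw [hsplit]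
  rw [Finset.sum_add_distrib]
  -- the bounds
  have hD : ∀ i : Fin N, (1 / 2) * ((P.vol - ((N - 1 : ℕ) : ℝ) * P.ε) * P.formᵢ N i f f) ≤
      ∫ w, P.sliceGen N i f w ^ 2 ∂P.ν N := fun i => by
    have := P.integral_sliceGen_sq_ge N i hfm hfb; linarith
  have hO : ∀ i : Fin N, ∑ j ∈ Finset.univ.erase i, -(P.ε / 2 * (P.formᵢ N i f f + P.formᵢ N j f f)) ≤
      ∑ j ∈ Finset.univ.erase i, ∫ w, P.sliceGen N i f w * P.sliceGen N j f w ∂P.ν N := fun i =>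
    Finset.sum_le_sum fun j hj => P.integral_sliceGen_mul_sliceGen_ge N i j
      (Finset.mem_erase.1 hj).1.symm hfm hfb
  have hsumD := Finset.sum_le_sum fun i (_ : i ∈ Finset.univ) => hD i
  have hsumO := Finset.sum_le_sum fun i (_ : i ∈ Finset.univ) => hO i
  -- evaluate the lower bounds
  have hOval : ∑ i, ∑ j ∈ Finset.univ.erase i, -(P.ε / 2 * (P.formᵢ N i f f + P.formᵢ N j f f)) =
      -(P.ε * ((N - 1 : ℕ) : ℝ) * ∑ i, P.formᵢ N i f f) := by
    have h1 : ∀ i : Fin N, ∑ j ∈ Finset.univ.erase i, -(P.ε / 2 * (P.formᵢ N i f f + P.formᵢ N j f f)) =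
        -(P.ε / 2) * (((N - 1 : ℕ) : ℝ) * P.formᵢ N i f f + ∑ j ∈ Finset.univ.erase i, P.formᵢ N j f f) := by
      intro i
      rw [Finset.sum_neg_distrib, ← Finset.mul_sum, Finset.sum_add_distrib, Finset.sum_const,
        Finset.card_erase_of_mem (Finset.mem_univ i), Finset.card_univ, Fintype.card_fin, nsmul_eq_mul]
      ring
    simp_rw [h1]
    rw [← Finset.mul_sum, Finset.sum_add_distrib, sum_sum_erase_right, ← Finset.mul_sum]
    ring
  have hDval : ∑ i, (1 / 2) * ((P.vol - ((N - 1 : ℕ) : ℝ) * P.ε) * P.formᵢ N i f f) =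
      (1 / 2) * (P.vol - ((N - 1 : ℕ) : ℝ) * P.ε) * ∑ i, P.formᵢ N i f f := by
    rw [Finset.mul_sum]
    exact Finset.sum_congr rfl fun i _ => by ring
  rw [hOval] at hsumO
  rw [hDval] at hsumD
  -- the left-hand side
  have hform : P.form N f f = P.vol⁻¹ / 2 * ∑ i, P.formᵢ N i f f := by rw [form, Finset.mul_sum]
  have hvol := P.vol_pos
  have hS : 0 ≤ ∑ i, P.formᵢ N i f f := Finset.sum_nonneg fun i _ => P.formᵢ_self_nonneg N i f
  rw [hform]
  have key : (1 / 2) * (P.vol - 3 * ((N - 1 : ℕ) : ℝ) * P.ε) * ∑ i, P.formᵢ N i f f ≤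
      ∑ i, ∫ w, P.sliceGen N i f w ^ 2 ∂P.ν N +
        ∑ i, ∑ j ∈ Finset.univ.erase i, ∫ w, P.sliceGen N i f w * P.sliceGen N j f w ∂P.ν N := by
    nlinarith [hsumD, hsumO]
  calc (1 - 3 * ((N - 1 : ℕ) : ℝ) * P.ε / P.vol) * (P.vol⁻¹ / 2 * ∑ i, P.formᵢ N i f f)
      = P.vol⁻¹ ^ 2 * ((1 / 2) * (P.vol - 3 * ((N - 1 : ℕ) : ℝ) * P.ε) * ∑ i, P.formᵢ N i f f) := by
        field_simp
    _ ≤ _ := mul_le_mul_of_nonneg_left key (sq_nonneg _)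

end GasModel

end Estimate

/-! ### Assembly: the Poincaré inequality -/

section Main

variable {d N : ℕ}

namespace GasModel

variable (P : GasModel d) (N)

/-- The slice `z ↦ ∫ rate_i(z, w) (f(w^{i→z}) - f(w))² ν(dw)` is measurable and bounded. [folklore] -/
theorem measurable_integral_rate_mul_sq (i : Fin N) {f : Conf d N → ℝ} (hfm : Measurable f) :
    Measurable fun z => ∫ w, P.rate N i z w * (f (update w i z) - f w) ^ 2 ∂P.ν N := by
  have hF : Measurable fun p : Conf d N × Pt d => P.rate N i p.2 p.1 * (f (update p.1 i p.2) - f p.1) ^ 2 :=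
    (P.measurable_rate N i).mul (((hfm.comp measurable_update').sub (hfm.comp measurable_fst)).pow_const 2)
  exact (hF.stronglyMeasurable.integral_prod_left' (μ := P.ν N)).measurable

/-- **The Dirichlet form of the statement is `ℰ(f, f)`** (Fubini):
`½ ∫_Λ dz/|Λ| ν[Σ_i rate_i (f(w^{i→z}) - f(w))²] = Σ_i |Λ|⁻¹/2 ∫ (∇̃_i f)² dR_i`.
[cite: BoudouCaputoDaiPraPosta2006, §5 (5.3)] -/
theorem dirichlet_eq_form {f : Conf d N → ℝ} (hfm : Measurable f) (hfb : ∃ C, ∀ w, |f w| ≤ C) :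
    (1 / 2) * ∫ z, P.vol⁻¹ * (∫ w, (∑ i, P.rate N i z w * (f (update w i z) - f w) ^ 2) ∂P.ν N) ∂P.μ₀ =
      P.form N f f := by
  obtain ⟨C, hC⟩ := hfb
  -- the integrands
  set F : Fin N → Conf d N × Pt d → ℝ := fun i p => P.rate N i p.2 p.1 * (f (update p.1 i p.2) - f p.1) ^ 2
    with hF_def
  have hFm : ∀ i, Measurable (F i) := fun i =>
    (P.measurable_rate N i).mul (((hfm.comp measurable_update').sub (hfm.comp measurable_fst)).pow_const 2)
  have hFb : ∀ i p, |F i p| ≤ (2 * C) ^ 2 := by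
    intro i p
    simp only [hF_def]
    rw [abs_mul, abs_of_pos (P.rate_pos N i _ _), abs_pow]
    have h1 : |f (update p.1 i p.2) - f p.1| ≤ 2 * C := by
      have := abs_mgrad_le i hC p
      rwa [mgrad, abs_sub_comm] at this
    calc P.rate N i p.2 p.1 * |f (update p.1 i p.2) - f p.1| ^ 2 ≤ 1 * (2 * C) ^ 2 :=
          mul_le_mul (P.rate_le_one N i _ _) (pow_le_pow_left₀ (abs_nonneg _) h1 2) (sq_nonneg _) zero_le_one
      _ = (2 * C) ^ 2 := one_mul _
  -- `ℰ_i(f,f) = ∫_z ∫_w F i`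
  have hformᵢ : ∀ i, P.formᵢ N i f f = ∫ z, ∫ w, F i (w, z) ∂P.ν N ∂P.μ₀ := by
    intro i
    rw [formᵢ, P.integral_R N i, ← integral_prod_symm]
    · refine integral_congr_ae (Eventually.of_forall fun p => ?_)
      simp only [hF_def, mgrad, smul_eq_mul]; ring
    · exact integrable_of_bdd (hFm i) _ (hFb i)
  -- inner sums
  have hinner : ∀ z, ∫ w, (∑ i, P.rate N i z w * (f (update w i z) - f w) ^ 2) ∂P.ν N =
      ∑ i, ∫ w, F i (w, z) ∂P.ν N := by
    intro z
    rw [← integral_finsetSum _ fun i _ => ?_]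
    have hm : Measurable fun w => F i (w, z) := by
      have h := (hFm i).comp (measurable_prodMk_right (y := z))
      exact h
    exact integrable_of_bdd hm _ fun w => hFb i (w, z)
  have hIint : ∀ i, Integrable (fun z => ∫ w, F i (w, z) ∂P.ν N) P.μ₀ := by
    intro i
    refine integrable_of_bdd (P.measurable_integral_rate_mul_sq N i hfm) ((2 * C) ^ 2) fun z => ?_
    rw [← Real.norm_eq_abs]
    have h := norm_integral_le_of_norm_le_const (μ := P.ν N) (f := fun w => F i (w, z)) (C := (2 * C) ^ 2)
      (Eventually.of_forall fun w => by rw [Real.norm_eq_abs]; exact hFb i (w, z))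
    rwa [probReal_univ, mul_one] at h
  simp_rw [hinner]
  rw [integral_const_mul, integral_finsetSum _ fun i _ => hIint i, form, Finset.mul_sum, Finset.mul_sum]
  refine Finset.sum_congr rfl fun i _ => ?_
  rw [hformᵢ i]
  ring

/-- `ℰ` does not see additive constants. [folklore] -/
theorem form_sub_const (f : Conf d N → ℝ) (m : ℝ) :
    P.form N (fun w => f w - m) (fun w => f w - m) = P.form N f f := by
  simp only [form, formᵢ, mgrad_sub_const]

/-- **The spectral gap bound** (BCDP 2006 Thm 5.1 + Cor. 5.2 through Prop. 2.1): for bounded measurable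
`f`, `(1 - 3(N-1)ε(β)/|Λ|) Var_ν(f) ≤ ℰ(f, f)`. [cite: BoudouCaputoDaiPraPosta2006, §5 Cor. 5.2] -/
theorem gap {f : Conf d N → ℝ} (hfm : Measurable f) (hfb : ∃ C, ∀ w, |f w| ≤ C) :
    (1 - 3 * ((N : ℝ) - 1) * P.ε / P.vol) * ProbabilityTheory.variance f (P.ν N) ≤ P.form N f f := by
  obtain ⟨C, hC⟩ := hfb
  set k : ℝ := 1 - 3 * ((N : ℝ) - 1) * P.ε / P.vol with hk_def
  set m : ℝ := ∫ w, f w ∂P.ν N with hm_def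
  -- the centred function
  set u : Conf d N → ℝ := fun w => f w - m with hu_def
  have hum : Measurable u := hfm.sub measurable_const
  have huC : ∀ w, |u w| ≤ C + |m| := fun w => (abs_sub _ _).trans (add_le_add (hC w) le_rfl)
  have hfi : Integrable f (P.ν N) := integrable_of_bdd hfm C hC
  have hu0 : ∫ w, u w ∂P.ν N = 0 := by
    simp only [hu_def]
    rw [integral_sub hfi (integrable_const m), integral_const, probReal_univ, one_smul, hm_def, sub_self]
  set xu : Lp ℝ 2 (P.ν N) := (P.memLp_of_bdd N hum huC).toLp u with hxu_def
  -- the abstract criterion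
  have hBE : ∀ y ∈ P.bddClasses N, k * ⟪P.genOp N y, y⟫_ℝ ≤ ‖P.genOp N y‖ ^ 2 := by
    rintro y ⟨g, hgm, ⟨Cg, hCg⟩, hyg⟩
    have hy : y = (P.memLp_of_bdd N hgm hCg).toLp g := by
      rw [← Lp.toLp_coeFn y (Lp.memLp y)]; exact MemLp.toLp_congr _ _ hyg
    rw [hy, P.inner_genOp_toLp_self N hgm hCg, P.norm_genOp_toLp_sq N hgm hCg]
    exact P.bakryEmery_estimate N hgm ⟨Cg, hCg⟩
  have hker : ∀ y, P.genOp N y = 0 → ⟪y, xu⟫_ℝ = 0 := fun y hy =>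
    P.inner_eq_zero_of_genOp_eq_zero N hy _ hu0
  have h := le_inner_map_self_of_forall_ker (P.genOp N) (P.inner_genOp_comm N)
    (P.inner_genOp_self_nonneg N) (P.dense_bddClasses N) hBE hker
  -- identify the two sides
  have hnorm : ‖xu‖ ^ 2 = ProbabilityTheory.variance f (P.ν N) := by
    rw [← real_inner_self_eq_norm_sq, hxu_def, P.inner_toLp_toLp N hum huC hum huC,
      ProbabilityTheory.variance_eq_integral hfm.aemeasurable]
    refine integral_congr_ae (Eventually.of_forall fun w => ?_)
    simp only [hu_def, hm_def, sq]
  have hinner : ⟪P.genOp N xu, xu⟫_ℝ = P.form N f f := by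
    rw [hxu_def, P.inner_genOp_toLp_self N hum huC, hu_def, form_sub_const]
  rw [hnorm, hinner] at h
  exact h

end GasModel

/-- **Boudou–Caputo–Dai Pra–Posta 2006, §5 Corollary 5.2** (spectral gap of the Kawasaki-type
dynamics of the canonical continuum gas): discharge of the named fact `BCDP2006_canonicalGas_gap`.
The proof follows the paper: the Bochner-type identity (Lemma 2.1) gives
`ν[(𝓛f)²] ≥ ∫ νcc(1-r)∇f∇f = A + B`, the diagonal term `A ≥ (1-ε₁)𝓔(f,f)` by reversibility ((5.5)–(5.6)),
`|B| ≤ ε₂ 𝓔(f,f)`, `ε₁ + ε₂ ≤ 3(N-1)ε(β)/|Λ|` (Cor. 5.2), and the Bakry–Émery inequality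
`k 𝓔(f,f) ≤ ν[(𝓛f)²]` yields `gap(𝓛) ≥ k` (Prop. 2.1, here via Cauchy–Schwarz for `⟪-𝓛·,·⟫` and
density of `range 𝓛` in the orthogonal complement of `ker 𝓛 = ` constants).
[cite: BoudouCaputoDaiPraPosta2006, §5 Corollary 5.2 (arXiv:math/0505533 p. 13)] -/
theorem BCDP2006_canonicalGas_gap_holds : BCDP2006_canonicalGas_gap := by
  intro d N φ β Λ hφm hφ0 hφe hβ hint hΛm hΛb hΛ0
  dsimp only
  intro f hfm hfb _hfsym
  let P : GasModel d := ⟨φ, β, Λ, hφm, hφ0, hφe, hβ.le, hint, hΛm, hΛb, hΛ0⟩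
  have h1 := P.gap N hfm hfb
  rw [← P.dirichlet_eq_form N hfm hfb] at h1
  exact h1

end Main

end

end Literature.MathematicalPhysics.StatisticalMechanics
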